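import Summits.ResolutionOfSingularities.ResolutionOfSingularities.Theses.WildQuotients
import Summits.ResolutionOfSingularities.ResolutionOfSingularities.Theorems.PAlterationAssembly
import Summits.ResolutionOfSingularities.ResolutionOfSingularities.Theorems.PAlterationPalterationThesisPialtOfPerfect
import Summits.ResolutionOfSingularities.ResolutionOfSingularities.Theorems.PAlterationPialtNormalProjective
import Summits.ResolutionOfSingularities.ResolutionOfSingularities.Theorems.WildQuotientsGaloisQuotientAlteration
import Summits.ResolutionOfSingularities.ResolutionOfSingularities.Theorems.WildQuotientsSummitReductionStubPairTransport
import Summits.ResolutionOfSingularities.ResolutionOfSingularities.Theorems.WildQuotientsSummitReductionStubPairDimZero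
import Summits.ResolutionOfSingularities.ResolutionOfSingularities.Theorems.WildQuotientsSummitReductionSemiStablePairLemmas
import Summits.ResolutionOfSingularities.ResolutionOfSingularities.Theorems.WildQuotientsSummitReductionStubPairEquivariantFibration
import Summits.ResolutionOfSingularities.ResolutionOfSingularities.Theorems.WildQuotientsSummitReductionStubPairCanonicalStrictification
import Summits.ResolutionOfSingularities.ResolutionOfSingularities.Theorems.WildQuotientsSummitReductionStubPairRegularBaseChangeReduction
import Summits.ResolutionOfSingularities.ResolutionOfSingularities.Theorems.WildQuotientsSummitReductionStubPairSsCodimThreeAssembly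
import Summits.ResolutionOfSingularities.ResolutionOfSingularities.Theorems.WildQuotientsSummitReductionStubPairNodeThickness
import Summits.ResolutionOfSingularities.ResolutionOfSingularities.Theorems.WildQuotientsSummitReductionStubPairOrbitBlowupClaimOfCentre
import Summits.ResolutionOfSingularities.ResolutionOfSingularities.Theorems.WildQuotientsSummitReductionStubPairSsOrbitBlowup7Reduction
import Summits.ResolutionOfSingularities.ResolutionOfSingularities.Theorems.WildQuotientsSummitReductionStubPairQuasiSplitBaseChange
import Summits.ResolutionOfSingularities.ResolutionOfSingularities.Theorems.WildQuotientsSummitReductionStubPairOrbitBlowupCentreFlat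
import Summits.ResolutionOfSingularities.ResolutionOfSingularities.Theorems.WildQuotientsSummitReductionStubPairOrbitBlowupCentreNew
import Summits.ResolutionOfSingularities.ResolutionOfSingularities.Theorems.WildQuotientsSummitReductionStubPairQuasiSplitNormalForm
import Summits.ResolutionOfSingularities.ResolutionOfSingularities.Theorems.WildQuotientsSummitReductionStubPairOrbitNormalFormBlowupReduction
import Summits.ResolutionOfSingularities.ResolutionOfSingularities.Theorems.WildQuotientsSummitReductionStubPairOrbitNormalFormBlowupSingularOverCentre
import Summits.ResolutionOfSingularities.ResolutionOfSingularities.Theorems.WildQuotientsSummitReductionStubPairOrbitNormalFormBlowupStrictTransformRegular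
import Summits.ResolutionOfSingularities.ResolutionOfSingularities.Theorems.WildQuotientsSummitReductionStubPairEquivariantSemiStableReductionOfDeJong59
import Summits.ResolutionOfSingularities.ResolutionOfSingularities.Theorems.WildQuotientsSummitReductionStubPairOrbitBlowupCentreLocal
import Summits.ResolutionOfSingularities.ResolutionOfSingularities.Theorems.WildQuotientsSummitReductionStubPairOrbitNormalFormBlowupModelSingularOverCentre
import Summits.ResolutionOfSingularities.ResolutionOfSingularities.Theorems.WildQuotientsSummitReductionStubPairOrbitNormalFormBlowupChartsOverCentreReduction2
import Summits.ResolutionOfSingularities.ResolutionOfSingularities.Theorems.WildQuotientsSummitReductionStubPairOrbitNormalFormBlowupModelChartsOverCentre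
import Literature.AlgebraicGeometry.Resolution.AlterationsSemiStable
import Literature.AlgebraicGeometry.Resolution.QuasiSplitSemiStableCurveFibrations
import Literature.AlgebraicGeometry.Resolution.AlterationsSemiStableResolution
import Literature.AlgebraicGeometry.Resolution.StrictNormalCrossings
import Literature.AlgebraicGeometry.Motives.SymmetricPowerProjective
import Mathlib.AlgebraicGeometry.Geometrically.Irreducible
import HarnessLib

/-!
# Crux `WildQuotients.SummitReduction` (stmt-ResolutionOfSingularities-16324) — line `FramePerfect`
# SKELETON v12 (lead prover c4): de Jong's equivariant alteration theorem in PAIR format by induction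
# on `dim X` (de Jong 1997 §5), final layer — ONE stub, a named fact

`SummitReduction := ∀ p prime, WQ_p → PICover_p → ResolutionInChar p`; closed in tree modulo the named
fact `DeJong1997_galoisAlterationQuasiProjective` (`Theorems.summitReduction_of_deJong1997`). Since v2
the input is squeezed to de Jong's Galois alteration of NORMAL PROJECTIVE `X` over PERFECT fields
(frame landed p129952); since v4 it is typed in de Jong's PAIR format (`deJong1997_pair_perfect`);
v5 proved the pair statement by induction on `dim X` (architecture of the tree's non-equivariant
de Jong DAG) modulo four stubs, v6 cut the two crux-sized ones along de Jong 1997 §5 / Prop. 5.11,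
v7 cut A (equivariant Lemma 3.2) into the node thickness bound hT and the one-orbit blow-up Claim hB.
LANDED so far (all `--supports` the crux): `stub_pair_transport` p133983, `stub_pair_dimZero`
p133912 (v5); `stub_pair_equivariantFibration` p138150 (1a = de Jong 1997 Lemma 5.2 equivariant,
five lemma files), `stub_pair_canonicalStrictification` p136673 (C = de Jong 1996 7.2, two lemma
files), `stub_pair_nodeThickness` p139268 (hT = de Jong 1996 3.3–3.4: `2 ≤ n(x) < ∞`, any field,
quasi-split), the pull-back step 1c modulo quasi-splitness of base changes
(`stub_pair_regularBaseChange_of_quasiSplitBaseChange` p137317 with p136376/p136938/p137197; the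
algebra of the base change p140481 + `…QuasiSplitBaseChangeAlgebra`), the codimension-three step A
modulo hT/hB (`stub_pair_ssCodimThree_of_thickness_of_orbitBlowup` p137059 with
p136186/p136481/p136712), hB off the exceptional locus (`stub_pair_orbitBlowupClaim_core_of_centre`,
`quasiSplit_comp_of_isBlowup_vanishingIdeal` p140232 with p140003), the orbit blow-up iteration of
B (`ssOrbitBlowup_of_invariant` p135914/p136105) with its invariant DEFINED in Literature
(`DeJong1997.QuasiSplitNormalFormPair`, p139488) and B from its entry and step
(`stub_pair_ssOrbitBlowup_of_normalForm_of_orbitClaim` p140166 with p139813), and the Prop. 5.11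
bookkeeping (p134455).

v12 (this file): waves 4–6 LANDED every geometric stub of the line — QS (p144476), C1 (p145250),
C2 (p158319), C3 (p145857), N (p144595), NB1 (p158187), NB2 (p171745), the GLUE of 1b (p151258) — with
~110 helper files; de Jong's equivariant alteration theorem over a perfect field, and with it the crux,
is PROVED modulo ONE registered stub, a Literature NAMED FACT —
* `stub_pair_deJong1997Theorem59` (T59) = `DeJong1997_quasiSplitSemiStableCurveFibration` (de Jong
  1997 Thm. 5.9 in relative dimension 1 = Thm. 2.4 + Rem. 2.5 + Lemma 5.7 + (5.4.1): equivariant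
  quasi-split semi-stable reduction of a curve fibration over a Galois alteration of the base — the one
  non-local input of the induction; p149780; closes when the fact is proved in Literature).
The sorry-free CONDITIONAL form `summitReduction_of_deJong1997Theorem59 : T59 → SummitReduction` is
landed as `Theorems/WildQuotientsSummitReductionOfDeJong1997Theorem59.lean`.
PROVED here: everything else — `pair_equivariantSemiStableReduction` (1b from T59 by the landed GLUE),
`pair_regularBaseChange` (1c), `pair_reductionToSemiStablePair`, `pair_orbitBlowupClaim` (hB),
`pair_ssCodimThree` (A), `pair_orbitNormalFormBlowup_chartsOverCentre` (O3), `pair_orbitNormalFormBlowup`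
(S), `pair_ssOrbitBlowup` (B), `pair_semiStablePairResolution` (Prop. 5.11), `pair_statementUpToDim`,
`deJong1997_pair_perfect`, and the v2–v4 tail down to `SummitReduction_of`.

Typing notes: "quasi-split" on completed FIBRE local rings `𝒪_{X,x}/𝔪_{f x}𝒪_{X,x} ≅ κ(f x)⟦u,v⟧/(uv)`
compatibly with `κ(f x)` at every non-smooth point; "`G`-strict" per de Jong 1996 7.1; boundary =
`DeJong1996.semiStableBoundary`; "generic fibre a geometrically irreducible curve" = Mathlib's
`GeometricallyIrreducible (fc.fiberToSpecResidueField (genericPoint Y))` + `dim (fc.fiber η) = 1`;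
`IsModification`, `IsNormalCrossingsDivisor`, `Scheme.singularLocusCodimLE`, `Scheme.Hom.nodeThickness`,
`IsBlowup`, `vanishingIdeal`, `IsOrdinaryDoublePoint`, `DeJong1997.QuasiSplitNormalFormPair` are the tree's.
-/

set_option linter.dupNamespace false

noncomputable section

open CategoryTheory CategoryTheory.Limits AlgebraicGeometry TopologicalSpace
open Literature.AlgebraicGeometry.Resolution Literature.AlgebraicGeometry.RelativeSpec
open Literature.AlgebraicGeometry.Motives (RatFn.functionFieldMap RatFn.functionFieldMap_comp)
open Literature.AlgebraicGeometry

namespace Summit.ResolutionOfSingularities.ResolutionOfSingularities.Theorems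

/-! ## Stub 1b (XL): equivariant quasi-split semi-stable reduction of the fibration over a Galois
alteration of the base (de Jong 1997, Thm. 2.4 + Rem. 2.5 + Lemma 5.7) -/

/-- STUB T59 (the one non-local input of the induction; held by the lead as a NAMED FACT).
**De Jong 1997, Thm. 5.9 in relative dimension `1` over a projective variety** (= Thm. 2.4 with
Rem. 2.5 made quasi-split by Lemma 5.7 and (5.4.1)-adjusted by Lemma 5.5): equivariant quasi-split
semi-stable reduction of a family of curves over a Galois alteration of the base — vendored in
Literature as `DeJong1997_quasiSplitSemiStableCurveFibration` (QuasiSplitSemiStableCurveFibrations.lean);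
this stub closes when `…_holds` is proved there. [cite: DeJong1997, Thm. 5.9, Thm. 2.4, Rem. 2.5, Lemma 5.7, pp. 602–603, 613–617] -/
theorem stub_pair_deJong1997Theorem59 : DeJong1997_quasiSplitSemiStableCurveFibration.{0} := by
  sorry

-- GLUE LANDED (p151258): `stub_pair_equivariantSemiStableReduction_of_deJong59` is imported from
-- `…StubPairEquivariantSemiStableReductionOfDeJong59`.


/-- **Stub 1b (v6–v9's `stub_pair_equivariantSemiStableReduction`, same signature) PROVED modulo
T59 and GLUE.** [cite: DeJong1997, Thm. 5.9, Thm. 2.4, Rem. 2.5, Lemma 5.7, pp. 602–603, 613–617] -/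
theorem pair_equivariantSemiStableReduction (k : Type) [Field k] (d : ℕ)
    (X : Scheme.{0}) [IsIntegral X] (f : X ⟶ Spec (.of k))
    (G : Type) [Group G] [Finite G] (ρ : G →* Aut X)
    (Z : Set X) (hZ : IsClosed Z) (hZne : Z ≠ Set.univ)
    (hZG : ∀ g : G, (ρ g).hom.base '' Z ⊆ Z)
    (X' : Scheme.{0}) [IsIntegral X'] (φ : X' ⟶ X) (ρX' : G →* Aut X') (Y : Scheme.{0})
    [IsIntegral Y] (q : Y ⟶ Spec (.of k)) (ρY : G →* Aut Y) (fc : X' ⟶ Y)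
    (hφ : IsModification φ) (hφG : ∀ g : G, (ρX' g).hom ≫ φ = φ ≫ (ρ g).hom)
    (hprojX' : Motives.IsProjectiveOver (Over.mk (φ ≫ f))) (hprojY : Motives.IsProjectiveOver (Over.mk q))
    (hρY : ∀ g : G, (ρY g).hom ≫ q = q) (hfcG : ∀ g : G, (ρX' g).hom ≫ fc = fc ≫ (ρY g).hom)
    (hcomm : fc ≫ q = φ ≫ f) (hdimY : topologicalKrullDim Y = (d : ℕ))
    (hfib : topologicalKrullDim ↥(fc.fiber (genericPoint Y)) = 1)
    (hgi : GeometricallyIrreducible (fc.fiberToSpecResidueField (genericPoint Y))) :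
    ∃ (G₁ : Type) (_ : Group G₁) (_ : Finite G₁) (X₁ Y₁ : Scheme.{0}) (_ : IsIntegral X₁)
      (_ : IsIntegral Y₁) (f₁ : X₁ ⟶ Y₁) (q₁ : Y₁ ⟶ Spec (.of k)) (ρX₁ : G₁ →* Aut X₁)
      (ρY₁ : G₁ →* Aut Y₁) (D₁ : Set Y₁) (hD₁ : IsClosed D₁) (m : ℕ) (σ : Fin m → (Y₁ ⟶ X₁)),
  Motives.IsProjectiveOver (Over.mk (f₁ ≫ q₁)) ∧
      Motives.IsProjectiveOver (Over.mk q₁) ∧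
      (∀ g : G₁, (ρY₁ g).hom ≫ q₁ = q₁) ∧
      topologicalKrullDim Y₁ ≤ (d : ℕ) ∧
      D₁ ≠ Set.univ ∧
      (∀ g : G₁, (ρY₁ g).hom.base '' D₁ = D₁) ∧
      IsSemiStableCurve f₁ ∧
      (∀ x : X₁, (¬ ∃ U : X₁.Opens, x ∈ U ∧ Smooth (U.ι ≫ f₁)) →
        ∃ e : AdicCompletion
            ((IsLocalRing.maximalIdeal (X₁.presheaf.stalk x)).map (Ideal.Quotient.mk
              ((IsLocalRing.maximalIdeal (Y₁.presheaf.stalk (f₁.base x))).map (f₁.stalkMap x).hom)))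
            (X₁.presheaf.stalk x ⧸
              (IsLocalRing.maximalIdeal (Y₁.presheaf.stalk (f₁.base x))).map (f₁.stalkMap x).hom) ≃+*
          MvPowerSeries (Fin 2) (Y₁.presheaf.stalk (f₁.base x) ⧸ IsLocalRing.maximalIdeal (Y₁.presheaf.stalk (f₁.base x))) ⧸
            Ideal.span {(MvPowerSeries.X 0 * MvPowerSeries.X 1 :
              MvPowerSeries (Fin 2) (Y₁.presheaf.stalk (f₁.base x) ⧸ IsLocalRing.maximalIdeal (Y₁.presheaf.stalk (f₁.base x))))},
          e.toRingHom.comp ((algebraMap (X₁.presheaf.stalk x ⧸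
              (IsLocalRing.maximalIdeal (Y₁.presheaf.stalk (f₁.base x))).map (f₁.stalkMap x).hom) _).comp
            (Ideal.quotientMap ((IsLocalRing.maximalIdeal (Y₁.presheaf.stalk (f₁.base x))).map (f₁.stalkMap x).hom)
              (f₁.stalkMap x).hom Ideal.le_comap_map)) =
          algebraMap (Y₁.presheaf.stalk (f₁.base x) ⧸ IsLocalRing.maximalIdeal (Y₁.presheaf.stalk (f₁.base x))) _) ∧
      Smooth (f₁ ∣_ ⟨D₁ᶜ, hD₁.isOpen_compl⟩) ∧
      GeometricallyIrreducible (f₁.fiberToSpecResidueField (genericPoint Y₁)) ∧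
      (∀ i : Fin m, σ i ≫ f₁ = 𝟙 Y₁) ∧
      (Pairwise fun i j : Fin m => Disjoint (Set.range (σ i)) (Set.range (σ j))) ∧
      (∀ i : Fin m, ∃ U : X₁.Opens, Set.range (σ i) ⊆ (U : Set X₁) ∧ Smooth (U.ι ≫ f₁)) ∧
      (∀ g : G₁, (ρX₁ g).hom ≫ f₁ = f₁ ≫ (ρY₁ g).hom) ∧
      (∀ (g : G₁) (i : Fin m), ∃ j : Fin m, σ i ≫ (ρX₁ g).hom = (ρY₁ g).hom ≫ σ j) ∧
      ∃ (φ₁ : G₁ →* G) (π₁ : X₁ ⟶ X) (_ : IsDominant π₁),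
        Function.Surjective φ₁ ∧
        IsAlteration π₁ ∧
        f₁ ≫ q₁ = π₁ ≫ f ∧
        (∀ g : G₁, (ρX₁ g).hom ≫ π₁ = π₁ ≫ (ρ (φ₁ g)).hom) ∧
        (∀ a : X₁.functionField, (∀ g : G₁, RatFn.functionFieldMap (ρX₁ g).hom a = a) →
          ∃ (n : ℕ) (c : X.functionField), (∀ g : G, RatFn.functionFieldMap (ρ g).hom c = c) ∧
            a ^ ringExpChar X.functionField ^ n = RatFn.functionFieldMap π₁ c) ∧
        π₁.base ⁻¹' Z ⊆ DeJong1996.semiStableBoundary f₁ D₁ σ :=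
  stub_pair_equivariantSemiStableReduction_of_deJong59 stub_pair_deJong1997Theorem59 k d X f G ρ Z hZ hZne hZG X' φ ρX' Y q ρY fc hφ hφG hprojX' hprojY hρY hfcG hcomm hdimY hfib hgi


/-! ## QS LANDED (p144476): quasi-splitness is stable under base change -/

-- QS LANDED (p144476): `stub_pair_quasiSplitBaseChange` is imported from `…StubPairQuasiSplitBaseChange`.

/-! ## 1c, proved modulo stub QS: pull-back to the regular base (de Jong 1997, 5.4; landed
reduction p137317 re-run with the projectivity of the new base recorded) -/

/-- **Base change of the `G₁`-semi-stable model along the regular Galois alteration of the base**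
(de Jong 1997, 5.4 and the step "(5.12.1) for the base" in the proof of Thm. 5.13) — the 1c worker's
`stub_pair_regularBaseChange_of_quasiSplitBaseChange` (p137317: the pull-back `X₁ ×_{Y₁} Y₂`, the
group `G' = {(g₂, g₁) | ρ₂ g₂ ≫ ψ₂ = ψ₂ ≫ ρY₁ g₁}` ⊇ graph of `φ₂`, satisfying (5.4.1), the compositum
`K(X₁ ×_{Y₁} Y₂) = K(X₁) · K(Y₂)` and the purely inseparable clause `galois_clause_pullback`), with
its hypothesis `hQS` supplied by `stub_pair_quasiSplitBaseChange` and ONE MORE CONJUNCT in the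
conclusion: the new base `Y' = Y₂` is projective over `k` (it is, by the induction hypothesis).
Proof copied from the landed file with `hproj₂` recorded. [cite: DeJong1997, 5.4 and proof of Thm. 5.13, pp. 613, 620] -/
theorem pair_regularBaseChange (k : Type) [Field k]
    (X : Scheme.{0}) [IsIntegral X] (f : X ⟶ Spec (.of k))
    (G : Type) [Group G] [Finite G] (ρ : G →* Aut X) (Z : Set X)
    (G₁ : Type) [Group G₁] [Finite G₁] (X₁ Y₁ : Scheme.{0}) [IsIntegral X₁] [IsIntegral Y₁]
    (f₁ : X₁ ⟶ Y₁) (q₁ : Y₁ ⟶ Spec (.of k)) (ρX₁ : G₁ →* Aut X₁) (ρY₁ : G₁ →* Aut Y₁)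
    (D₁ : Set Y₁) (hD₁ : IsClosed D₁) (m : ℕ) (σ : Fin m → (Y₁ ⟶ X₁))
    (hprojX₁ : Motives.IsProjectiveOver (Over.mk (f₁ ≫ q₁)))
    (hss₁ : IsSemiStableCurve f₁)
    (hqs₁ : (∀ x : X₁, (¬ ∃ U : X₁.Opens, x ∈ U ∧ Smooth (U.ι ≫ f₁)) →
        ∃ e : AdicCompletion
            ((IsLocalRing.maximalIdeal (X₁.presheaf.stalk x)).map (Ideal.Quotient.mk
              ((IsLocalRing.maximalIdeal (Y₁.presheaf.stalk (f₁.base x))).map (f₁.stalkMap x).hom)))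
            (X₁.presheaf.stalk x ⧸
              (IsLocalRing.maximalIdeal (Y₁.presheaf.stalk (f₁.base x))).map (f₁.stalkMap x).hom) ≃+*
          MvPowerSeries (Fin 2) (Y₁.presheaf.stalk (f₁.base x) ⧸ IsLocalRing.maximalIdeal (Y₁.presheaf.stalk (f₁.base x))) ⧸
            Ideal.span {(MvPowerSeries.X 0 * MvPowerSeries.X 1 :
              MvPowerSeries (Fin 2) (Y₁.presheaf.stalk (f₁.base x) ⧸ IsLocalRing.maximalIdeal (Y₁.presheaf.stalk (f₁.base x))))},
          e.toRingHom.comp ((algebraMap (X₁.presheaf.stalk x ⧸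
              (IsLocalRing.maximalIdeal (Y₁.presheaf.stalk (f₁.base x))).map (f₁.stalkMap x).hom) _).comp
            (Ideal.quotientMap ((IsLocalRing.maximalIdeal (Y₁.presheaf.stalk (f₁.base x))).map (f₁.stalkMap x).hom)
              (f₁.stalkMap x).hom Ideal.le_comap_map)) =
          algebraMap (Y₁.presheaf.stalk (f₁.base x) ⧸ IsLocalRing.maximalIdeal (Y₁.presheaf.stalk (f₁.base x))) _))
    (hsm₁ : Smooth (f₁ ∣_ ⟨D₁ᶜ, hD₁.isOpen_compl⟩))
    (_hgi₁ : GeometricallyIrreducible (f₁.fiberToSpecResidueField (genericPoint Y₁)))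
    (hσf : (∀ i : Fin m, σ i ≫ f₁ = 𝟙 Y₁))
    (hσdisj : (Pairwise fun i j : Fin m => Disjoint (Set.range (σ i)) (Set.range (σ j))))
    (hσsm : (∀ i : Fin m, ∃ U : X₁.Opens, Set.range (σ i) ⊆ (U : Set X₁) ∧ Smooth (U.ι ≫ f₁)))
    (hf₁G : (∀ g : G₁, (ρX₁ g).hom ≫ f₁ = f₁ ≫ (ρY₁ g).hom))
    (hσG : (∀ (g : G₁) (i : Fin m), ∃ j : Fin m, σ i ≫ (ρX₁ g).hom = (ρY₁ g).hom ≫ σ j))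
    (φ₁ : G₁ →* G) (π₁ : X₁ ⟶ X) [IsDominant π₁]
    (hφsurj : Function.Surjective φ₁)
    (hπalt : IsAlteration π₁)
    (hπcomm : f₁ ≫ q₁ = π₁ ≫ f)
    (hπG : (∀ g : G₁, (ρX₁ g).hom ≫ π₁ = π₁ ≫ (ρ (φ₁ g)).hom))
    (hgal : (∀ a : X₁.functionField, (∀ g : G₁, RatFn.functionFieldMap (ρX₁ g).hom a = a) →
        ∃ (n : ℕ) (c : X.functionField), (∀ g : G, RatFn.functionFieldMap (ρ g).hom c = c) ∧
          a ^ ringExpChar X.functionField ^ n = RatFn.functionFieldMap π₁ c))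
    (hZbd : π₁.base ⁻¹' Z ⊆ DeJong1996.semiStableBoundary f₁ D₁ σ)
    (hbase : ∃ (G₂ : Type) (_ : Group G₂) (_ : Finite G₂) (X₂ : Scheme.{0}) (_ : IsIntegral X₂)
        (ρ₂ : G₂ →* Aut X₂) (φ₂ : G₂ →* G₁) (π₂ : X₂ ⟶ Y₁) (_ : IsDominant π₂),
        Function.Surjective φ₂ ∧ IsAlteration π₂ ∧ Scheme.IsRegular X₂ ∧
        Motives.IsProjectiveOver (Over.mk (π₂ ≫ q₁)) ∧
        (∀ g : G₂, (ρ₂ g).hom ≫ π₂ = π₂ ≫ (ρY₁ (φ₂ g)).hom) ∧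
        (∀ a : X₂.functionField, (∀ g : G₂, RatFn.functionFieldMap (ρ₂ g).hom a = a) →
          ∃ (n : ℕ) (c : Y₁.functionField), (∀ g : G₁, RatFn.functionFieldMap (ρY₁ g).hom c = c) ∧
            a ^ ringExpChar Y₁.functionField ^ n = RatFn.functionFieldMap π₂ c) ∧
        ∃ D₂ : Set X₂, IsStrictNormalCrossingsDivisor X₂ D₂ ∧ π₂.base ⁻¹' (D₁) ⊆ D₂ ∧
          (∀ g : G₂, (ρ₂ g).hom.base '' D₂ = D₂) ∧
          (∀ (g : G₂) (C : Set X₂), Maximal (fun C : Set X₂ => IsIrreducible C ∧ C ⊆ D₂) C →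
            (C ∩ (ρ₂ g).hom.base '' C).Nonempty → (ρ₂ g).hom.base '' C = C)) :
    ∃ (G' : Type) (_ : Group G') (_ : Finite G') (X' Y' : Scheme.{0}) (_ : IsIntegral X')
      (_ : IsIntegral Y') (f' : X' ⟶ Y') (q' : Y' ⟶ Spec (.of k)) (ρX' : G' →* Aut X')
      (ρY' : G' →* Aut Y') (D' : Set Y') (hD' : IsStrictNormalCrossingsDivisor Y' D') (m : ℕ)
      (τ : Fin m → (Y' ⟶ X')),
      Motives.IsProjectiveOver (Over.mk (f' ≫ q')) ∧
      Motives.IsProjectiveOver (Over.mk q') ∧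
      Scheme.IsRegular Y' ∧
      (∀ g : G', (ρY' g).hom.base '' D' = D') ∧
      (∀ (g : G') (C : Set Y'), Maximal (fun C : Set Y' => IsIrreducible C ∧ C ⊆ D') C →
        (C ∩ (ρY' g).hom.base '' C).Nonempty → (ρY' g).hom.base '' C = C) ∧
      IsSemiStableCurve f' ∧
      (∀ x : X', (¬ ∃ U : X'.Opens, x ∈ U ∧ Smooth (U.ι ≫ f')) →
        ∃ e : AdicCompletion
            ((IsLocalRing.maximalIdeal (X'.presheaf.stalk x)).map (Ideal.Quotient.mk
              ((IsLocalRing.maximalIdeal (Y'.presheaf.stalk (f'.base x))).map (f'.stalkMap x).hom)))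
            (X'.presheaf.stalk x ⧸
              (IsLocalRing.maximalIdeal (Y'.presheaf.stalk (f'.base x))).map (f'.stalkMap x).hom) ≃+*
          MvPowerSeries (Fin 2) (Y'.presheaf.stalk (f'.base x) ⧸ IsLocalRing.maximalIdeal (Y'.presheaf.stalk (f'.base x))) ⧸
            Ideal.span {(MvPowerSeries.X 0 * MvPowerSeries.X 1 :
              MvPowerSeries (Fin 2) (Y'.presheaf.stalk (f'.base x) ⧸ IsLocalRing.maximalIdeal (Y'.presheaf.stalk (f'.base x))))},
          e.toRingHom.comp ((algebraMap (X'.presheaf.stalk x ⧸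
              (IsLocalRing.maximalIdeal (Y'.presheaf.stalk (f'.base x))).map (f'.stalkMap x).hom) _).comp
            (Ideal.quotientMap ((IsLocalRing.maximalIdeal (Y'.presheaf.stalk (f'.base x))).map (f'.stalkMap x).hom)
              (f'.stalkMap x).hom Ideal.le_comap_map)) =
          algebraMap (Y'.presheaf.stalk (f'.base x) ⧸ IsLocalRing.maximalIdeal (Y'.presheaf.stalk (f'.base x))) _) ∧
      Smooth (f' ∣_ ⟨D'ᶜ, hD'.isClosed.isOpen_compl⟩) ∧
      (∀ i : Fin m, τ i ≫ f' = 𝟙 Y') ∧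
      (Pairwise fun i j : Fin m => Disjoint (Set.range (τ i)) (Set.range (τ j))) ∧
      (∀ i : Fin m, ∃ U : X'.Opens, Set.range (τ i) ⊆ (U : Set X') ∧ Smooth (U.ι ≫ f')) ∧
      (∀ g : G', (ρX' g).hom ≫ f' = f' ≫ (ρY' g).hom) ∧
      (∀ (g : G') (i : Fin m), ∃ j : Fin m, τ i ≫ (ρX' g).hom = (ρY' g).hom ≫ τ j) ∧
      ∃ (φ' : G' →* G) (π' : X' ⟶ X) (_ : IsDominant π'),
        Function.Surjective φ' ∧ IsAlteration π' ∧ f' ≫ q' = π' ≫ f ∧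
        (∀ g : G', (ρX' g).hom ≫ π' = π' ≫ (ρ (φ' g)).hom) ∧
        (∀ a : X'.functionField, (∀ g : G', RatFn.functionFieldMap (ρX' g).hom a = a) →
          ∃ (n : ℕ) (c : X.functionField), (∀ g : G, RatFn.functionFieldMap (ρ g).hom c = c) ∧
            a ^ ringExpChar X.functionField ^ n = RatFn.functionFieldMap π' c) ∧
        π'.base ⁻¹' Z ⊆ DeJong1996.semiStableBoundary f' D' τ := by
  obtain ⟨G₂, _, _, Y₂, _, ρ₂, φ₂, ψ₂, _, hφ₂, hψ₂alt, hreg₂, hproj₂, hψ₂G, hgal₂, D₂, hD₂, hD₁D₂,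
    hD₂stab, hD₂strict⟩ := hbase
  -- standing instances
  haveI := hss₁.flat
  haveI := hss₁.isProper
  haveI : Surjective f₁ := semiStableCurve_surjective hss₁
  haveI := hψ₂alt.isProper
  haveI : Surjective ψ₂ := hψ₂alt.surjective
  have hη : genericPoint Y₁ ∉ D₁ := genericPoint_notMem_of_preimage_subset_sncd ψ₂ hD₂ hD₁D₂
  haveI : IsIntegral (pullback f₁ ψ₂) :=
    isIntegral_pullback_of_isSemiStableCurve hss₁ hD₁ hsm₁ hη ψ₂
  haveI : IsProper (f₁ ≫ q₁) := Motives.IsProjectiveOver.isProper (X := Over.mk (f₁ ≫ q₁)) hprojX₁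
  haveI : IsSeparated (f₁ ≫ q₁) := inferInstance
  haveI : X₁.IsSeparated := (HasAffineProperty.iff_of_isAffine (P := @IsSeparated)).mp ‹_›
  haveI : Y₁.IsSeparated := isSeparated_base_of_isSemiStableCurve hss₁
  haveI : IsProper (ψ₂ ≫ q₁) := Motives.IsProjectiveOver.isProper (X := Over.mk (ψ₂ ≫ q₁)) hproj₂
  haveI : IsLocallyNoetherian X₁ := LocallyOfFiniteType.isLocallyNoetherian (f₁ ≫ q₁)
  haveI : IsLocallyNoetherian Y₂ := LocallyOfFiniteType.isLocallyNoetherian (ψ₂ ≫ q₁)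
  -- the group `G' = {(g₂, g₁) | ρ₂ g₂ covers ρY₁ g₁ along ψ₂}` (it contains the graph of `φ₂` and,
  -- by the rigidity of `ψ₂`, every `(g₂, 1)` with `g₂` acting trivially on `K(Y₁)`: (5.4.1))
  let G' : Subgroup (G₂ × G₁) :=
    { carrier := {g | (ρ₂ g.1).hom ≫ ψ₂ = ψ₂ ≫ (ρY₁ g.2).hom}
      mul_mem' := fun {a b} ha hb => by
        simp only [Set.mem_setOf_eq, Prod.fst_mul, Prod.snd_mul, map_mul, Aut.Aut_mul_def,
          Iso.trans_hom, Category.assoc] at ha hb ⊢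
        rw [ha, reassoc_of% hb]
      one_mem' := by
        simp only [Set.mem_setOf_eq, Prod.fst_one, Prod.snd_one, map_one]
        show 𝟙 _ ≫ ψ₂ = ψ₂ ≫ 𝟙 _
        simp
      inv_mem' := fun {a} ha => by
        simp only [Set.mem_setOf_eq, Prod.fst_inv, Prod.snd_inv, map_inv, Aut.Aut_inv_def,
          Iso.symm_hom] at ha ⊢
        rw [Iso.inv_comp_eq, ← Category.assoc, ha, Category.assoc, Iso.hom_inv_id,
          Category.comp_id] }
  let pr₁ : G' →* G₂ := (MonoidHom.fst G₂ G₁).comp G'.subtype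
  let pr₂ : G' →* G₁ := (MonoidHom.snd G₂ G₁).comp G'.subtype
  -- the action of `G'` on `P = X₁ ×_{Y₁} Y₂`
  let θ : G' → (pullback f₁ ψ₂ ⟶ pullback f₁ ψ₂) := fun g =>
    pullback.map f₁ ψ₂ f₁ ψ₂ (ρX₁ g.1.2).hom (ρ₂ g.1.1).hom (ρY₁ g.1.2).hom (hf₁G g.1.2).symm
      (show (ρ₂ g.1.1).hom ≫ ψ₂ = ψ₂ ≫ (ρY₁ g.1.2).hom from g.2).symm
  have θfst : ∀ g, θ g ≫ pullback.fst f₁ ψ₂ = pullback.fst f₁ ψ₂ ≫ (ρX₁ g.1.2).hom :=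
    fun g => pullback.lift_fst _ _ _
  have θsnd : ∀ g, θ g ≫ pullback.snd f₁ ψ₂ = pullback.snd f₁ ψ₂ ≫ (ρ₂ g.1.1).hom :=
    fun g => pullback.lift_snd _ _ _
  have θone : θ 1 = 𝟙 _ := by
    apply pullback.hom_ext
    · rw [θfst, Category.id_comp]
      show _ ≫ (ρX₁ 1).hom = _
      rw [map_one]
      exact Category.comp_id _
    · rw [θsnd, Category.id_comp]
      show _ ≫ (ρ₂ 1).hom = _
      rw [map_one]
      exact Category.comp_id _
  have θmul : ∀ g h, θ (g * h) = θ h ≫ θ g := fun g h => by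
    apply pullback.hom_ext
    · rw [θfst, Category.assoc, θfst, reassoc_of% (θfst h)]
      show _ ≫ (ρX₁ (g.1.2 * h.1.2)).hom = _
      rw [map_mul, Aut.Aut_mul_def, Iso.trans_hom]
    · rw [θsnd, Category.assoc, θsnd, reassoc_of% (θsnd h)]
      show _ ≫ (ρ₂ (g.1.1 * h.1.1)).hom = _
      rw [map_mul, Aut.Aut_mul_def, Iso.trans_hom]
  let ρP : G' →* Aut (pullback f₁ ψ₂) :=
    { toFun := fun g => ⟨θ g, θ g⁻¹, by rw [← θmul, inv_mul_cancel, θone],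
        by rw [← θmul, mul_inv_cancel, θone]⟩
      map_one' := Iso.ext θone
      map_mul' := fun g h => Iso.ext (by rw [Aut.Aut_mul_def, Iso.trans_hom]; exact θmul g h) }
  have hρP : ∀ g, (ρP g).hom = θ g := fun g => rfl
  have hρP₁ : ∀ g, (ρP g).hom ≫ pullback.fst f₁ ψ₂ = pullback.fst f₁ ψ₂ ≫ (ρX₁ (pr₂ g)).hom :=
    fun g => θfst g
  have hρP₂ : ∀ g, (ρP g).hom ≫ pullback.snd f₁ ψ₂ = pullback.snd f₁ ψ₂ ≫ (ρ₂ (pr₁ g)).hom :=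
    fun g => θsnd g
  have hlift : Function.Surjective pr₂ := fun g₁ => by
    obtain ⟨g₂, rfl⟩ := hφ₂ g₁
    exact ⟨⟨(g₂, φ₂ g₂), hψ₂G g₂⟩, rfl⟩
  have hker : ∀ g₂ : G₂, (ρ₂ g₂).hom ≫ ψ₂ = ψ₂ → ∃ g : G', pr₁ g = g₂ ∧ pr₂ g = 1 := fun g₂ h =>
    ⟨⟨(g₂, 1), by
      show (ρ₂ g₂).hom ≫ ψ₂ = ψ₂ ≫ (ρY₁ 1).hom
      rw [map_one, h]
      exact (Category.comp_id _).symm⟩, rfl, rfl⟩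
  haveI : Finite G' := inferInstance
  refine ⟨G', inferInstance, inferInstance, pullback f₁ ψ₂, Y₂, inferInstance, inferInstance,
    pullback.snd f₁ ψ₂, ψ₂ ≫ q₁, ρP, ρ₂.comp pr₁, D₂, hD₂, m,
    DeJong1996.PreSemiStablePair.pullbackSection hσf ψ₂,
    isProjectiveOver_pullback_of_isSemiStableCurve hss₁ q₁ hprojX₁ ψ₂ hproj₂, hproj₂, hreg₂,
    fun g => hD₂stab (pr₁ g), fun g C hC hne => hD₂strict (pr₁ g) C hC hne, hss₁.baseChange ψ₂,
    stub_pair_quasiSplitBaseChange f₁ ψ₂ hss₁ hqs₁, smooth_pullback_snd_morphismRestrict hD₁ hsm₁ ψ₂ hD₂.isClosed hD₁D₂,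
    fun i => DeJong1996.PreSemiStablePair.pullbackSection_snd hσf ψ₂ i,
    pairwise_disjoint_pullbackSection hσf hσdisj ψ₂, exists_smooth_pullbackSection hσf hσsm ψ₂,
    fun g => hρP₂ g, fun g i => ?_, φ₁.comp pr₂, pullback.fst f₁ ψ₂ ≫ π₁, inferInstance,
    hφsurj.comp hlift, (isAlteration_pullback_fst_of_isSemiStableCurve hss₁ hψ₂alt).comp hπalt,
    ?_, fun g => ?_, ?_, fun x hx => ?_⟩
  · -- the sections are permuted
    obtain ⟨j, hj⟩ := hσG g.1.2 i
    exact ⟨j, pullbackSection_comp_eq hσf ψ₂ (hρP₁ g) (hρP₂ g) g.2 hj⟩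
  · -- `f₂ ≫ ψ₂ ≫ q₁ = (fst ≫ π₁) ≫ f`
    rw [Category.assoc, ← hπcomm, ← pullback.condition_assoc]
  · -- equivariance of `fst ≫ π₁`
    rw [← Category.assoc, hρP₁ g, Category.assoc, hπG (pr₂ g), Category.assoc]
    rfl
  · -- the purely inseparable clause (de Jong 1997, 5.4)
    exact galois_clause_pullback ρ f₁ ρX₁ ρY₁ π₁ hgal ρ₂ φ₂ ψ₂ hψ₂G hgal₂ (functionFieldMap_fieldRange_sup_eq_top f₁ ψ₂)
      pr₁ pr₂ ρP hρP₁ hρP₂ hlift hker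
  · -- the boundary
    exact preimage_fst_semiStableBoundary_subset hσf ψ₂ hD₁D₂ (hZbd hx)

/-! ## v5 stub 1, proved: 1a (LANDED p138150), 1b, the induction hypothesis on the base, 1c -/

/-- **De Jong 1997, proof of Thm. 5.13 (first half) over `S = Spec k`, `k` perfect** (v5's
`stub_pair_reductionToSemiStablePair`, with `Y'` projective added to the conclusion in v7): from the
pair statement in dimension `≤ d` and a projective pair `(X, G, Z)` of dimension `d + 1`, a
`G'`-semi-stable pair over a REGULAR projective base with `G'`-strict sncd boundary and its Galois
link to `(X, G, Z)` — fibre (`stub_pair_equivariantFibration`, landed), reduce semi-stably over a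
Galois alteration of the base (1b), resolve the base pair by the induction hypothesis, pull back (1c).
[cite: DeJong1997, proof of Thm. 5.13, p. 620] -/
theorem pair_reductionToSemiStablePair (k : Type) [Field k] [PerfectField k] (d : ℕ)
    (ih : ∀ (X : Scheme.{0}) [IsIntegral X] (f : X ⟶ Spec (.of k)),
        Motives.IsProjectiveOver (Over.mk f) →
        ∀ (G : Type) [Group G] [Finite G] (ρ : G →* Aut X), (∀ g : G, (ρ g).hom ≫ f = f) →
        ∀ (Z : Set X), IsClosed Z → Z ≠ Set.univ → (∀ g : G, (ρ g).hom.base '' Z ⊆ Z) →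
        topologicalKrullDim X ≤ (d : ℕ) →
        ∃ (G₁ : Type) (_ : Group G₁) (_ : Finite G₁) (X₁ : Scheme.{0}) (_ : IsIntegral X₁)
          (ρ₁ : G₁ →* Aut X₁) (φ₁ : G₁ →* G) (π₁ : X₁ ⟶ X) (_ : IsDominant π₁),
          Function.Surjective φ₁ ∧ IsAlteration π₁ ∧ Scheme.IsRegular X₁ ∧
          Motives.IsProjectiveOver (Over.mk (π₁ ≫ f)) ∧
          (∀ g : G₁, (ρ₁ g).hom ≫ π₁ = π₁ ≫ (ρ (φ₁ g)).hom) ∧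
          (∀ a : X₁.functionField, (∀ g : G₁, RatFn.functionFieldMap (ρ₁ g).hom a = a) →
            ∃ (n : ℕ) (c : X.functionField), (∀ g : G, RatFn.functionFieldMap (ρ g).hom c = c) ∧
              a ^ ringExpChar X.functionField ^ n = RatFn.functionFieldMap π₁ c) ∧
          ∃ D₁ : Set X₁, IsStrictNormalCrossingsDivisor X₁ D₁ ∧ π₁.base ⁻¹' (Z) ⊆ D₁ ∧
            (∀ g : G₁, (ρ₁ g).hom.base '' D₁ = D₁) ∧
            (∀ (g : G₁) (C : Set X₁), Maximal (fun C : Set X₁ => IsIrreducible C ∧ C ⊆ D₁) C →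
              (C ∩ (ρ₁ g).hom.base '' C).Nonempty → (ρ₁ g).hom.base '' C = C))
    (X : Scheme.{0}) [IsIntegral X] (f : X ⟶ Spec (.of k))
    (hproj : Motives.IsProjectiveOver (Over.mk f))
    (G : Type) [Group G] [Finite G] (ρ : G →* Aut X) (hρ : ∀ g : G, (ρ g).hom ≫ f = f)
    (Z : Set X) (hZ : IsClosed Z) (hZne : Z ≠ Set.univ)
    (hZG : ∀ g : G, (ρ g).hom.base '' Z ⊆ Z)
    (hdim : topologicalKrullDim X = (d + 1 : ℕ)) :
    ∃ (G' : Type) (_ : Group G') (_ : Finite G') (X' Y' : Scheme.{0}) (_ : IsIntegral X')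
      (_ : IsIntegral Y') (f' : X' ⟶ Y') (q' : Y' ⟶ Spec (.of k)) (ρX' : G' →* Aut X')
      (ρY' : G' →* Aut Y') (D' : Set Y') (hD' : IsStrictNormalCrossingsDivisor Y' D') (m : ℕ)
      (τ : Fin m → (Y' ⟶ X')),
      Motives.IsProjectiveOver (Over.mk (f' ≫ q')) ∧
      Motives.IsProjectiveOver (Over.mk q') ∧
      Scheme.IsRegular Y' ∧
      (∀ g : G', (ρY' g).hom.base '' D' = D') ∧
      (∀ (g : G') (C : Set Y'), Maximal (fun C : Set Y' => IsIrreducible C ∧ C ⊆ D') C →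
        (C ∩ (ρY' g).hom.base '' C).Nonempty → (ρY' g).hom.base '' C = C) ∧
      IsSemiStableCurve f' ∧
      (∀ x : X', (¬ ∃ U : X'.Opens, x ∈ U ∧ Smooth (U.ι ≫ f')) →
        ∃ e : AdicCompletion
            ((IsLocalRing.maximalIdeal (X'.presheaf.stalk x)).map (Ideal.Quotient.mk
              ((IsLocalRing.maximalIdeal (Y'.presheaf.stalk (f'.base x))).map (f'.stalkMap x).hom)))
            (X'.presheaf.stalk x ⧸
              (IsLocalRing.maximalIdeal (Y'.presheaf.stalk (f'.base x))).map (f'.stalkMap x).hom) ≃+*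
          MvPowerSeries (Fin 2) (Y'.presheaf.stalk (f'.base x) ⧸ IsLocalRing.maximalIdeal (Y'.presheaf.stalk (f'.base x))) ⧸
            Ideal.span {(MvPowerSeries.X 0 * MvPowerSeries.X 1 :
              MvPowerSeries (Fin 2) (Y'.presheaf.stalk (f'.base x) ⧸ IsLocalRing.maximalIdeal (Y'.presheaf.stalk (f'.base x))))},
          e.toRingHom.comp ((algebraMap (X'.presheaf.stalk x ⧸
              (IsLocalRing.maximalIdeal (Y'.presheaf.stalk (f'.base x))).map (f'.stalkMap x).hom) _).comp
            (Ideal.quotientMap ((IsLocalRing.maximalIdeal (Y'.presheaf.stalk (f'.base x))).map (f'.stalkMap x).hom)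
              (f'.stalkMap x).hom Ideal.le_comap_map)) =
          algebraMap (Y'.presheaf.stalk (f'.base x) ⧸ IsLocalRing.maximalIdeal (Y'.presheaf.stalk (f'.base x))) _) ∧
      Smooth (f' ∣_ ⟨D'ᶜ, hD'.isClosed.isOpen_compl⟩) ∧
      (∀ i : Fin m, τ i ≫ f' = 𝟙 Y') ∧
      (Pairwise fun i j : Fin m => Disjoint (Set.range (τ i)) (Set.range (τ j))) ∧
      (∀ i : Fin m, ∃ U : X'.Opens, Set.range (τ i) ⊆ (U : Set X') ∧ Smooth (U.ι ≫ f')) ∧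
      (∀ g : G', (ρX' g).hom ≫ f' = f' ≫ (ρY' g).hom) ∧
      (∀ (g : G') (i : Fin m), ∃ j : Fin m, τ i ≫ (ρX' g).hom = (ρY' g).hom ≫ τ j) ∧
      ∃ (φ' : G' →* G) (π' : X' ⟶ X) (_ : IsDominant π'),
        Function.Surjective φ' ∧ IsAlteration π' ∧ f' ≫ q' = π' ≫ f ∧
        (∀ g : G', (ρX' g).hom ≫ π' = π' ≫ (ρ (φ' g)).hom) ∧
        (∀ a : X'.functionField, (∀ g : G', RatFn.functionFieldMap (ρX' g).hom a = a) →
          ∃ (n : ℕ) (c : X.functionField), (∀ g : G, RatFn.functionFieldMap (ρ g).hom c = c) ∧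
            a ^ ringExpChar X.functionField ^ n = RatFn.functionFieldMap π' c) ∧
        π'.base ⁻¹' Z ⊆ DeJong1996.semiStableBoundary f' D' τ := by
  obtain ⟨X', _, φ, ρX', Y, _, q, ρY, fc, hφ, hφG, hprojX', hprojY, hρY, hfcG, hcomm, hdimY, hfib, hgi⟩ :=
    stub_pair_equivariantFibration k d X f hproj G ρ hρ hdim
  obtain ⟨G₁, _, _, X₁, Y₁, _, _, f₁, q₁, ρX₁, ρY₁, D₁, hD₁, m, σ, hprojX₁, hprojY₁, hρY₁, hdimY₁, hD₁ne, hD₁G, hss₁, hqs₁, hsm₁, hgi₁, hσf, hσdisj, hσsm, hf₁G, hσG, φ₁, π₁, _, hφsurj, hπalt, hπcomm, hπG, hgal, hZbd⟩ :=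
    pair_equivariantSemiStableReduction k d X f G ρ Z hZ hZne hZG X' φ ρX' Y q ρY fc hφ hφG hprojX' hprojY hρY hfcG hcomm hdimY hfib hgi
  have hbase := ih Y₁ q₁ hprojY₁ G₁ ρY₁ hρY₁ D₁ hD₁ hD₁ne (fun g => (hD₁G g).subset) hdimY₁
  exact pair_regularBaseChange k X f G ρ Z G₁ X₁ Y₁ f₁ q₁ ρX₁ ρY₁ D₁ hD₁ m σ
    hprojX₁ hss₁ hqs₁ hsm₁ hgi₁ hσf hσdisj hσsm hf₁G hσG φ₁ π₁ hφsurj hπalt hπcomm hπG hgal hZbd hbase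

/-! ## hT LANDED (p139268): `stub_pair_nodeThickness` is imported from
`…StubPairNodeThickness` (de Jong 1996, 3.3–3.4: `2 ≤ n(x) < ∞`, any field, quasi-split). -/

/-! ## Stubs C1–C3 (next layer of hB, v8): de Jong 1996, 3.4 Claim OVER THE CENTRE `cl(G · x)`

The hB worker (wave 3) proved everything in the Claim that happens off the exceptional locus
(`…StubPairOrbitBlowupClaimLemmas`, `…OfCentre`, p140003/p140232): hB is
`⟨core.1, quasiSplit_comp_of_isBlowup_vanishingIdeal …, core.2⟩` given six statements (H1)–(H6) at
the points OVER `Z = cl(G · x)`, read in print off the three charts of the blow-up of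
`B' = A⟦u, v⟧/(uv - t₁^{n₁} ⋯ t_r^{n_r})` in `(u, v, t₁)` (de Jong 1996, p. 64). As `D` is `G`-strict
and `f` quasi-split, `cl(G · x)` is a DISJOINT union of translates `ρ(g) cl{x}`, each mapping
isomorphically onto a component of `D` (de Jong 1997, proof of 5.11 ¶1), so locally on `X` the
centre is the closure of ONE codimension-2 singular point and the blow-up localises
(`IsBlowup.restrict`, `IsBlowup.comp_iso`): each stub is the any-field quasi-split form of a tree
theorem for one component over an algebraically closed field. Binders: those of hB. -/

-- C1 LANDED (p145250): `stub_pair_orbitBlowupCentreFlat` is imported from `…StubPairOrbitBlowupCentreFlat`.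


-- C2 LANDED (p158319): `stub_pair_orbitBlowupCentreLocal` is imported from `…StubPairOrbitBlowupCentreLocal`.


-- C3 LANDED (p145857): `stub_pair_orbitBlowupCentreNew` is imported from `…StubPairOrbitBlowupCentreNew`.


/-! ## hB, proved modulo C1–C3: the Claim of de Jong 1996, 3.4 for one orbit blow-up -/

/-- **De Jong 1996, 3.4, the Claim (ii)–(iii) for ONE blow-up of the reduced orbit closure
`cl(G · x)`** of a codimension-2 singular point of a `G`-semi-stable pair of the line, with (iv)
quasi-splitness upstairs (v7's `stub_pair_orbitBlowupClaim`, same signature): from C1–C3 by the hB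
worker's landed `stub_pair_orbitBlowupClaim_core_of_centre` and
`quasiSplit_comp_of_isBlowup_vanishingIdeal` (p140232: off `cl(G · x)` the blow-up is a local
isomorphism over `Y`). [cite: DeJong1996, 3.4, pp. 63–64] [cite: DeJong1997, proof of Prop. 5.11, p. 618] -/
theorem pair_orbitBlowupClaim (k : Type) [Field k] (Y : Scheme.{0}) [IsIntegral Y]
    (q : Y ⟶ Spec (.of k)) (hprojY : Motives.IsProjectiveOver (Over.mk q))
    (hreg : Scheme.IsRegular Y) (D : Set Y)
    (hD : IsStrictNormalCrossingsDivisor Y D) (G : Type) [Group G] [Finite G] (ρY : G →* Aut Y)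
    (hDG : (∀ g : G, (ρY g).hom.base '' D = D))
    (hDstrict : (∀ (g : G) (C : Set Y), Maximal (fun C : Set Y => IsIrreducible C ∧ C ⊆ D) C →
        (C ∩ (ρY g).hom.base '' C).Nonempty → (ρY g).hom.base '' C = C))
    (X : Scheme.{0}) [IsIntegral X] (f : X ⟶ Y) (ρX : G →* Aut X)
    (hprojX : Motives.IsProjectiveOver (Over.mk (f ≫ q)))
    (hρf : ∀ g : G, (ρX g).hom ≫ f = f ≫ (ρY g).hom) (hss : IsSemiStableCurve f)
    (hqs : (∀ x : X, (¬ ∃ U : X.Opens, x ∈ U ∧ Smooth (U.ι ≫ f)) →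
        ∃ e : AdicCompletion
            ((IsLocalRing.maximalIdeal (X.presheaf.stalk x)).map (Ideal.Quotient.mk
              ((IsLocalRing.maximalIdeal (Y.presheaf.stalk (f.base x))).map (f.stalkMap x).hom)))
            (X.presheaf.stalk x ⧸
              (IsLocalRing.maximalIdeal (Y.presheaf.stalk (f.base x))).map (f.stalkMap x).hom) ≃+*
          MvPowerSeries (Fin 2) (Y.presheaf.stalk (f.base x) ⧸ IsLocalRing.maximalIdeal (Y.presheaf.stalk (f.base x))) ⧸
            Ideal.span {(MvPowerSeries.X 0 * MvPowerSeries.X 1 :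
              MvPowerSeries (Fin 2) (Y.presheaf.stalk (f.base x) ⧸ IsLocalRing.maximalIdeal (Y.presheaf.stalk (f.base x))))},
          e.toRingHom.comp ((algebraMap (X.presheaf.stalk x ⧸
              (IsLocalRing.maximalIdeal (Y.presheaf.stalk (f.base x))).map (f.stalkMap x).hom) _).comp
            (Ideal.quotientMap ((IsLocalRing.maximalIdeal (Y.presheaf.stalk (f.base x))).map (f.stalkMap x).hom)
              (f.stalkMap x).hom Ideal.le_comap_map)) =
          algebraMap (Y.presheaf.stalk (f.base x) ⧸ IsLocalRing.maximalIdeal (Y.presheaf.stalk (f.base x))) _))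
    (hsm : Smooth (f ∣_ ⟨Dᶜ, hD.isClosed.isOpen_compl⟩))
    (x : X) (hx : x ∈ Scheme.singularLocusCodimLE X 2) (X₁ : Scheme.{0}) (π : X₁ ⟶ X)
    (hπ : IsBlowup π (Scheme.IdealSheafData.vanishingIdeal
      ⟨closure (Set.range fun g : G => (ρX g).hom.base x), isClosed_closure⟩)) :
    IsSemiStableCurve (π ≫ f) ∧
    (∀ x : X₁, (¬ ∃ U : X₁.Opens, x ∈ U ∧ Smooth (U.ι ≫ (π ≫ f))) →
        ∃ e : AdicCompletion
            ((IsLocalRing.maximalIdeal (X₁.presheaf.stalk x)).map (Ideal.Quotient.mk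
              ((IsLocalRing.maximalIdeal (Y.presheaf.stalk ((π ≫ f).base x))).map ((π ≫ f).stalkMap x).hom)))
            (X₁.presheaf.stalk x ⧸
              (IsLocalRing.maximalIdeal (Y.presheaf.stalk ((π ≫ f).base x))).map ((π ≫ f).stalkMap x).hom) ≃+*
          MvPowerSeries (Fin 2) (Y.presheaf.stalk ((π ≫ f).base x) ⧸ IsLocalRing.maximalIdeal (Y.presheaf.stalk ((π ≫ f).base x))) ⧸
            Ideal.span {(MvPowerSeries.X 0 * MvPowerSeries.X 1 :
              MvPowerSeries (Fin 2) (Y.presheaf.stalk ((π ≫ f).base x) ⧸ IsLocalRing.maximalIdeal (Y.presheaf.stalk ((π ≫ f).base x))))},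
          e.toRingHom.comp ((algebraMap (X₁.presheaf.stalk x ⧸
              (IsLocalRing.maximalIdeal (Y.presheaf.stalk ((π ≫ f).base x))).map ((π ≫ f).stalkMap x).hom) _).comp
            (Ideal.quotientMap ((IsLocalRing.maximalIdeal (Y.presheaf.stalk ((π ≫ f).base x))).map ((π ≫ f).stalkMap x).hom)
              ((π ≫ f).stalkMap x).hom Ideal.le_comap_map)) =
          algebraMap (Y.presheaf.stalk ((π ≫ f).base x) ⧸ IsLocalRing.maximalIdeal (Y.presheaf.stalk ((π ≫ f).base x))) _) ∧
    Smooth ((π ≫ f) ∣_ ⟨Dᶜ, hD.isClosed.isOpen_compl⟩) ∧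
    Set.MapsTo π.base (Scheme.singularLocusCodimLE X₁ 2) (Scheme.singularLocusCodimLE X 2) ∧
    Set.InjOn π.base (Scheme.singularLocusCodimLE X₁ 2) ∧
    (∀ x₁ ∈ Scheme.singularLocusCodimLE X₁ 2,
      π.base x₁ ∉ Set.range (fun g : G => (ρX g).hom.base x) →
        Scheme.Hom.nodeThickness (π ≫ f) x₁ = Scheme.Hom.nodeThickness f (π.base x₁)) ∧
    (∀ x₁ ∈ Scheme.singularLocusCodimLE X₁ 2,
      π.base x₁ ∈ Set.range (fun g : G => (ρX g).hom.base x) →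
        Scheme.Hom.nodeThickness (π ≫ f) x₁ + 2 = Scheme.Hom.nodeThickness f x) := by
  obtain ⟨hflat, hconn⟩ := stub_pair_orbitBlowupCentreFlat k Y q hprojY hreg D hD G ρY hDG hDstrict X f ρX hprojX hρf hss hqs hsm x hx X₁ π hπ
  obtain ⟨hqsZ, hnodal⟩ := stub_pair_orbitBlowupCentreLocal k Y q hprojY hreg D hD G ρY hDG hDstrict X f ρX hprojX hρf hss hqs hsm x hx X₁ π hπ
  obtain ⟨hnew, huniq⟩ := stub_pair_orbitBlowupCentreNew k Y q hprojY hreg D hD G ρY hDG hDstrict X f ρX hprojX hρf hss hqs hsm x hx X₁ π hπ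
  have h := stub_pair_orbitBlowupClaim_core_of_centre k Y q hreg D hD G X f ρX hprojX hss hsm x hx X₁ π
    hπ hflat hnodal hconn hnew huniq
  exact ⟨h.1, quasiSplit_comp_of_isBlowup_vanishingIdeal f isClosed_closure hπ hqs hqsZ, h.2⟩

/-! ## A, proved modulo C1–C3: equivariant Lemma 3.2 (landed assembly p137059, landed hT p139268) -/

/-- **De Jong 1996, Lemma 3.2 made `G`-equivariant and quasi-split** (de Jong 1997, proof of
Prop. 5.11 ¶1; v6's `stub_pair_ssCodimThree` with `hprojY` added): from the node thickness bounds
(hT) and the one-orbit blow-up Claim (hB) by the A worker's landed equivariant induction on the number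
of codimension-2 singular orbits (`stub_pair_ssCodimThree_of_thickness_of_orbitBlowup`, p137059).
[cite: DeJong1996, Lemma 3.2 and 3.4, pp. 62–64] [cite: DeJong1997, proof of Prop. 5.11, p. 618] -/
theorem pair_ssCodimThree (k : Type) [Field k] (X Y : Scheme.{0}) [IsIntegral X] [IsIntegral Y]
    (f : X ⟶ Y) (q : Y ⟶ Spec (.of k))
    (hprojX : Motives.IsProjectiveOver (Over.mk (f ≫ q))) (hprojY : Motives.IsProjectiveOver (Over.mk q)) (hreg : Scheme.IsRegular Y)
    (D : Set Y) (hD : IsStrictNormalCrossingsDivisor Y D)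
    (G : Type) [Group G] [Finite G] (ρX : G →* Aut X) (ρY : G →* Aut Y)
    (hρf : (∀ g : G, (ρX g).hom ≫ f = f ≫ (ρY g).hom))
    (hDG : (∀ g : G, (ρY g).hom.base '' D = D))
    (hDstrict : (∀ (g : G) (C : Set Y), Maximal (fun C : Set Y => IsIrreducible C ∧ C ⊆ D) C →
        (C ∩ (ρY g).hom.base '' C).Nonempty → (ρY g).hom.base '' C = C))
    (hss : IsSemiStableCurve f)
    (hqs : (∀ x : X, (¬ ∃ U : X.Opens, x ∈ U ∧ Smooth (U.ι ≫ f)) →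
        ∃ e : AdicCompletion
            ((IsLocalRing.maximalIdeal (X.presheaf.stalk x)).map (Ideal.Quotient.mk
              ((IsLocalRing.maximalIdeal (Y.presheaf.stalk (f.base x))).map (f.stalkMap x).hom)))
            (X.presheaf.stalk x ⧸
              (IsLocalRing.maximalIdeal (Y.presheaf.stalk (f.base x))).map (f.stalkMap x).hom) ≃+*
          MvPowerSeries (Fin 2) (Y.presheaf.stalk (f.base x) ⧸ IsLocalRing.maximalIdeal (Y.presheaf.stalk (f.base x))) ⧸
            Ideal.span {(MvPowerSeries.X 0 * MvPowerSeries.X 1 :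
              MvPowerSeries (Fin 2) (Y.presheaf.stalk (f.base x) ⧸ IsLocalRing.maximalIdeal (Y.presheaf.stalk (f.base x))))},
          e.toRingHom.comp ((algebraMap (X.presheaf.stalk x ⧸
              (IsLocalRing.maximalIdeal (Y.presheaf.stalk (f.base x))).map (f.stalkMap x).hom) _).comp
            (Ideal.quotientMap ((IsLocalRing.maximalIdeal (Y.presheaf.stalk (f.base x))).map (f.stalkMap x).hom)
              (f.stalkMap x).hom Ideal.le_comap_map)) =
          algebraMap (Y.presheaf.stalk (f.base x) ⧸ IsLocalRing.maximalIdeal (Y.presheaf.stalk (f.base x))) _))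
    (hsm : Smooth (f ∣_ ⟨Dᶜ, hD.isClosed.isOpen_compl⟩))
    (m : ℕ) (τ : Fin m → (Y ⟶ X)) (hτf : (∀ i : Fin m, τ i ≫ f = 𝟙 Y))
    (hτdisj : (Pairwise fun i j : Fin m => Disjoint (Set.range (τ i)) (Set.range (τ j))))
    (hτsm : (∀ i : Fin m, ∃ U : X.Opens, Set.range (τ i) ⊆ (U : Set X) ∧ Smooth (U.ι ≫ f)))
    (hτG : (∀ (g : G) (i : Fin m), ∃ j : Fin m, τ i ≫ (ρX g).hom = (ρY g).hom ≫ τ j)) :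
    ∃ (X' : Scheme.{0}) (_ : IsIntegral X') (φ : X' ⟶ X) (ρX' : G →* Aut X')
          (τ' : Fin m → (Y ⟶ X')),
          IsModification φ ∧ (∀ g : G, (ρX' g).hom ≫ φ = φ ≫ (ρX g).hom) ∧ (∀ i : Fin m, τ' i ≫ φ = τ i) ∧
          φ.base ⁻¹' DeJong1996.semiStableBoundary f D τ = DeJong1996.semiStableBoundary (φ ≫ f) D τ' ∧
          (∀ x : X', ¬ IsRegularLocalRing (X'.presheaf.stalk x) →
              (3 : WithBot ℕ∞) ≤ ringKrullDim (X'.presheaf.stalk x)) ∧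
          Motives.IsProjectiveOver (Over.mk ((φ ≫ f) ≫ q)) ∧
          IsSemiStableCurve (φ ≫ f) ∧
          (∀ x : X', (¬ ∃ U : X'.Opens, x ∈ U ∧ Smooth (U.ι ≫ (φ ≫ f))) →
                  ∃ e : AdicCompletion
                      ((IsLocalRing.maximalIdeal (X'.presheaf.stalk x)).map (Ideal.Quotient.mk
                        ((IsLocalRing.maximalIdeal (Y.presheaf.stalk ((φ ≫ f).base x))).map ((φ ≫ f).stalkMap x).hom)))
                      (X'.presheaf.stalk x ⧸
                        (IsLocalRing.maximalIdeal (Y.presheaf.stalk ((φ ≫ f).base x))).map ((φ ≫ f).stalkMap x).hom) ≃+*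
                    MvPowerSeries (Fin 2) (Y.presheaf.stalk ((φ ≫ f).base x) ⧸ IsLocalRing.maximalIdeal (Y.presheaf.stalk ((φ ≫ f).base x))) ⧸
                      Ideal.span {(MvPowerSeries.X 0 * MvPowerSeries.X 1 :
                        MvPowerSeries (Fin 2) (Y.presheaf.stalk ((φ ≫ f).base x) ⧸ IsLocalRing.maximalIdeal (Y.presheaf.stalk ((φ ≫ f).base x))))},
                    e.toRingHom.comp ((algebraMap (X'.presheaf.stalk x ⧸
                        (IsLocalRing.maximalIdeal (Y.presheaf.stalk ((φ ≫ f).base x))).map ((φ ≫ f).stalkMap x).hom) _).comp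
                      (Ideal.quotientMap ((IsLocalRing.maximalIdeal (Y.presheaf.stalk ((φ ≫ f).base x))).map ((φ ≫ f).stalkMap x).hom)
                        ((φ ≫ f).stalkMap x).hom Ideal.le_comap_map)) =
                    algebraMap (Y.presheaf.stalk ((φ ≫ f).base x) ⧸ IsLocalRing.maximalIdeal (Y.presheaf.stalk ((φ ≫ f).base x))) _) ∧
          Smooth ((φ ≫ f) ∣_ ⟨Dᶜ, hD.isClosed.isOpen_compl⟩) ∧
          (∀ i : Fin m, ∃ U : X'.Opens, Set.range (τ' i) ⊆ (U : Set X') ∧ Smooth (U.ι ≫ (φ ≫ f))) ∧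
          (∀ (g : G) (i : Fin m), ∃ j : Fin m, τ' i ≫ (ρX' g).hom = (ρY g).hom ≫ τ' j) :=
  stub_pair_ssCodimThree_of_thickness_of_orbitBlowup k X Y f q hprojX hreg D hD G ρX ρY hρf hDG
    hDstrict hss hqs hsm m τ hτf hτdisj hτsm hτG
    (fun X' _ f' h1 h2 h3 h4 x hx => stub_pair_nodeThickness k Y q hprojY hreg D hD X' f' h1 h2 h3 h4 x hx)
    (fun X' _ f' ρX' h1 h2 h3 h4 h5 x hx X₁ π hπ =>
      pair_orbitBlowupClaim k Y q hprojY hreg D hD G ρY hDG hDstrict X' f' ρX' h1 h2 h3 h4 h5 x hx X₁ π hπ)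

/-! ## Stubs N, S (next layer of B, v8) and B proved from them over a PERFECT field

The B worker (wave 3) DEFINED the invariant of de Jong's equivariant orbit blow-up iteration in
Literature (`DeJong1997.QuasiSplitNormalFormPair`, p139488: de Jong 1996 Situation 4.25 without
coefficient field and with `G`-orbits of singular components), proved the end of the iteration and
the centre bookkeeping, the formal/étale comparison of normal crossings over a perfect field
(p139813), and B from the two statements below (`stub_pair_ssOrbitBlowup_of_normalForm_of_orbitClaim`,
p140166) by the landed iteration `ssOrbitBlowup_of_invariant` (p135914/p136105). -/

-- N LANDED (p144595): `stub_pair_quasiSplitNormalForm` is imported from `…StubPairQuasiSplitNormalForm`.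


-- NB1 LANDED (p158187): `stub_pair_orbitNormalFormBlowup_modelSingularOverCentre` is imported from
-- `…StubPairOrbitNormalFormBlowupModelSingularOverCentre`.


-- NB2 LANDED (p171745): `stub_pair_orbitNormalFormBlowup_modelChartsOverCentre` is imported from
-- `…StubPairOrbitNormalFormBlowupModelChartsOverCentre`.


/-- **O3 (v9–v10's `stub_pair_orbitNormalFormBlowup_chartsOverCentre`, same signature) PROVED
modulo NB2** by the O3 worker's landed transfer `X' ↔ X' ×_X Spec 𝒪̂_{X,x} → Spec(model)`
(`stub_pair_orbitNormalFormBlowup_chartsOverCentre_of_model`, p154033 with p152753/p153904).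
[cite: DeJong1996, 4.27, pp. 75–76] [cite: DeJong1997, proof of Prop. 5.11, p. 619] -/
theorem pair_orbitNormalFormBlowup_chartsOverCentre (k : Type) [Field k] [PerfectField k] (G : Type) [Group G] [Finite G]
    (X : Scheme.{0}) (p : X ⟶ Spec (.of k)) (ρ : G →* Aut X) (Z : Set X) (d : ℕ)
    (hP : DeJong1997.QuasiSplitNormalFormPair p Z ρ d)
    (E : Set ↥({x : X | ¬ IsRegularLocalRing (X.presheaf.stalk x)} : Set X))
    (hE : E ∈ irreducibleComponents ↥({x : X | ¬ IsRegularLocalRing (X.presheaf.stalk x)} : Set X))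
    (X' : Scheme.{0}) (π : X' ⟶ X) (ρ' : G →* Aut X')
    (hπ : IsBlowup π (Scheme.IdealSheafData.vanishingIdeal
      ⟨closure (⋃ g : G, (ρ g).hom.base '' (Subtype.val '' E)), isClosed_closure⟩))
    (hπG : ∀ g : G, (ρ' g).hom ≫ π = π ≫ (ρ g).hom)
    (hproj' : Motives.IsProjectiveOver (Over.mk (π ≫ p))) :
    (∀ x' : X', IsClosed ({x'} : Set X') → ∀ [IsRegularLocalRing (X'.presheaf.stalk x')],
      x' ∈ π.base ⁻¹' Z → π.base x' ∈ closure (⋃ g : G, (ρ g).hom.base '' (Subtype.val '' E)) →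
        ∀ (U : X'.affineOpens) (hU : x' ∈ (U : X'.Opens)),
          IsSNCIdeal (completedStalkIdeal (Scheme.IdealSheafData.vanishingIdeal
            ⟨π.base ⁻¹' Z, hP.isClosed.preimage π.continuous⟩) x' U hU)) ∧
    (∀ x' : X', IsClosed ({x'} : Set X') → ¬ IsRegularLocalRing (X'.presheaf.stalk x') →
      π.base x' ∈ closure (⋃ g : G, (ρ g).hom.base '' (Subtype.val '' E)) →
        ∃ (A : Type) (_ : CommRing A) (_ : IsRegularLocalRing A) (t : Fin (d - 1) → A) (s r : ℕ),
          Ideal.span (Set.range t) = IsLocalRing.maximalIdeal A ∧ ringKrullDim A = (d - 1 : ℕ) ∧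
          2 ≤ s ∧ s ≤ r ∧ r ≤ d - 1 ∧
          ∃ e : AdicCompletion (IsLocalRing.maximalIdeal (X'.presheaf.stalk x'))
              (X'.presheaf.stalk x') ≃+*
              DeJong1996.NodeDeformationRing A
                (∏ i ∈ Finset.univ.filter (fun i : Fin (d - 1) => i.val < s), t i),
            ∀ (U : X'.affineOpens) (hU : x' ∈ (U : X'.Opens)),
              (completedStalkIdeal (Scheme.IdealSheafData.vanishingIdeal
                  ⟨π.base ⁻¹' Z, hP.isClosed.preimage π.continuous⟩) x' U hU).map e.toRingHom =
                Ideal.span {DeJong1996.NodeDeformationRing.ofBase A _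
                  (∏ i ∈ Finset.univ.filter (fun i : Fin (d - 1) => i.val < r), t i)}) :=
  stub_pair_orbitNormalFormBlowup_chartsOverCentre_of_model k G X p ρ Z d hP E hE X' π ρ' hπ hπG hproj'
    stub_pair_orbitNormalFormBlowup_modelChartsOverCentre


/-- **S (the orbit version of de Jong 1996, Claim 4.27; v8's `stub_pair_orbitNormalFormBlowup`,
same signature) PROVED modulo NB1 and O3** by the S worker's landed reduction: orbit centre =
disjoint union of translates (p141692), the count through strict transforms (p141695), the clauses
off the centre (p141697), the coefficient-free singular locus of the model and the formal ideal of
the centre (p142031/p142082/p143451/p144274), O2 = regularity of the strict transforms of the other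
orbits (p144431), O1 from NB1 (p144494), assembly `quasiSplitNormalFormPair_blowup_of_overCentre`
(p142026). [cite: DeJong1996, 4.27, pp. 75–76] [cite: DeJong1997, proof of Prop. 5.11, p. 619] -/
theorem pair_orbitNormalFormBlowup (k : Type) [Field k] [PerfectField k] (G : Type) [Group G] [Finite G]
    (X : Scheme.{0}) (p : X ⟶ Spec (.of k)) (ρ : G →* Aut X) (Z : Set X) (d : ℕ)
    (hP : DeJong1997.QuasiSplitNormalFormPair p Z ρ d)
    (E : Set ↥({x : X | ¬ IsRegularLocalRing (X.presheaf.stalk x)} : Set X))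
    (hE : E ∈ irreducibleComponents ↥({x : X | ¬ IsRegularLocalRing (X.presheaf.stalk x)} : Set X))
    (X' : Scheme.{0}) (π : X' ⟶ X) (ρ' : G →* Aut X')
    (hπ : IsBlowup π (Scheme.IdealSheafData.vanishingIdeal
      ⟨closure (⋃ g : G, (ρ g).hom.base '' (Subtype.val '' E)), isClosed_closure⟩))
    (hπG : ∀ g : G, (ρ' g).hom ≫ π = π ≫ (ρ g).hom)
    (hproj' : Motives.IsProjectiveOver (Over.mk (π ≫ p))) :
    DeJong1997.QuasiSplitNormalFormPair (π ≫ p) (π.base ⁻¹' Z) ρ' d ∧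
      (irreducibleComponents
          ↥({x : X' | ¬ IsRegularLocalRing (X'.presheaf.stalk x)} : Set X')).ncard <
        (irreducibleComponents
          ↥({x : X | ¬ IsRegularLocalRing (X.presheaf.stalk x)} : Set X)).ncard :=
  quasiSplitNormalFormPair_blowup_of_overCentre k G X p ρ Z d hP E hE X' π ρ' hπ hπG hproj'
    (stub_pair_orbitNormalFormBlowup_singularOverCentre_of_model k G X p ρ Z d hP E hE X' π hπ
      stub_pair_orbitNormalFormBlowup_modelSingularOverCentre)
    (stub_pair_orbitNormalFormBlowup_strictTransformOrbitRegular k G X p ρ Z d hP E hE X' π hπ)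
    (pair_orbitNormalFormBlowup_chartsOverCentre k G X p ρ Z d hP E hE X' π ρ' hπ hπG hproj').1
    (pair_orbitNormalFormBlowup_chartsOverCentre k G X p ρ Z d hP E hE X' π ρ' hπ hπG hproj').2


/-- **B over a perfect field** (v7's `stub_pair_ssOrbitBlowup` with `[PerfectField k]`, which the
line's induction `pair_statementUpToDim` supplies): de Jong 1996, 3.5 + 4.25–4.28 made
`G`-equivariant (de Jong 1997, 5.11 ¶2–3), from N and S by the B worker's landed reduction
`stub_pair_ssOrbitBlowup_of_normalForm_of_orbitClaim` (p140166). [cite: DeJong1996, 3.5, 4.25–4.28, pp. 64, 75–76]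
[cite: DeJong1997, proof of Prop. 5.11, p. 619] -/
theorem pair_ssOrbitBlowup (k : Type) [Field k] [PerfectField k] (X Y : Scheme.{0}) [IsIntegral X] [IsIntegral Y]
    (f : X ⟶ Y) (q : Y ⟶ Spec (.of k))
    (hprojX : Motives.IsProjectiveOver (Over.mk (f ≫ q))) (hprojY : Motives.IsProjectiveOver (Over.mk q)) (hreg : Scheme.IsRegular Y)
    (D : Set Y) (hD : IsStrictNormalCrossingsDivisor Y D)
    (G : Type) [Group G] [Finite G] (ρX : G →* Aut X) (ρY : G →* Aut Y)
    (hρf : (∀ g : G, (ρX g).hom ≫ f = f ≫ (ρY g).hom))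
    (hDG : (∀ g : G, (ρY g).hom.base '' D = D))
    (hDstrict : (∀ (g : G) (C : Set Y), Maximal (fun C : Set Y => IsIrreducible C ∧ C ⊆ D) C →
        (C ∩ (ρY g).hom.base '' C).Nonempty → (ρY g).hom.base '' C = C))
    (hss : IsSemiStableCurve f)
    (hqs : (∀ x : X, (¬ ∃ U : X.Opens, x ∈ U ∧ Smooth (U.ι ≫ f)) →
        ∃ e : AdicCompletion
            ((IsLocalRing.maximalIdeal (X.presheaf.stalk x)).map (Ideal.Quotient.mk
              ((IsLocalRing.maximalIdeal (Y.presheaf.stalk (f.base x))).map (f.stalkMap x).hom)))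
            (X.presheaf.stalk x ⧸
              (IsLocalRing.maximalIdeal (Y.presheaf.stalk (f.base x))).map (f.stalkMap x).hom) ≃+*
          MvPowerSeries (Fin 2) (Y.presheaf.stalk (f.base x) ⧸ IsLocalRing.maximalIdeal (Y.presheaf.stalk (f.base x))) ⧸
            Ideal.span {(MvPowerSeries.X 0 * MvPowerSeries.X 1 :
              MvPowerSeries (Fin 2) (Y.presheaf.stalk (f.base x) ⧸ IsLocalRing.maximalIdeal (Y.presheaf.stalk (f.base x))))},
          e.toRingHom.comp ((algebraMap (X.presheaf.stalk x ⧸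
              (IsLocalRing.maximalIdeal (Y.presheaf.stalk (f.base x))).map (f.stalkMap x).hom) _).comp
            (Ideal.quotientMap ((IsLocalRing.maximalIdeal (Y.presheaf.stalk (f.base x))).map (f.stalkMap x).hom)
              (f.stalkMap x).hom Ideal.le_comap_map)) =
          algebraMap (Y.presheaf.stalk (f.base x) ⧸ IsLocalRing.maximalIdeal (Y.presheaf.stalk (f.base x))) _))
    (hsm : Smooth (f ∣_ ⟨Dᶜ, hD.isClosed.isOpen_compl⟩))
    (m : ℕ) (τ : Fin m → (Y ⟶ X)) (hτf : (∀ i : Fin m, τ i ≫ f = 𝟙 Y))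
    (hτdisj : (Pairwise fun i j : Fin m => Disjoint (Set.range (τ i)) (Set.range (τ j))))
    (hτsm : (∀ i : Fin m, ∃ U : X.Opens, Set.range (τ i) ⊆ (U : Set X) ∧ Smooth (U.ι ≫ f)))
    (hτG : (∀ (g : G) (i : Fin m), ∃ j : Fin m, τ i ≫ (ρX g).hom = (ρY g).hom ≫ τ j))
    (hcodim : (∀ x : X, ¬ IsRegularLocalRing (X.presheaf.stalk x) →
            (3 : WithBot ℕ∞) ≤ ringKrullDim (X.presheaf.stalk x))) :
    ∃ (X' : Scheme.{0}) (_ : IsIntegral X') (ψ : X' ⟶ X) (ρX' : G →* Aut X'),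
          IsModification ψ ∧ (∀ g : G, (ρX' g).hom ≫ ψ = ψ ≫ (ρX g).hom) ∧
          Motives.IsProjectiveOver (Over.mk ((ψ ≫ f) ≫ q)) ∧ Scheme.IsRegular X' ∧
          IsNormalCrossingsDivisor X' (ψ.base ⁻¹' DeJong1996.semiStableBoundary f D τ) :=
  stub_pair_ssOrbitBlowup_of_normalForm_of_orbitClaim stub_pair_quasiSplitNormalForm
    pair_orbitNormalFormBlowup k X Y f q hprojX hprojY hreg D hD G ρX ρY hρf hDG hDstrict hss hqs hsm m τ hτf hτdisj hτsm hτG hcodim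

/-! ## Prop. 5.11 from A, B, C (cut by the stub-2 worker of wave 1; `hprojY` threaded in v7) -/

/-- **De Jong 1997, Prop. 5.11 (equivariant resolution of a `G`-semi-stable pair, pair format)
from its three printed blocks** — A (equivariant Lemma 3.2), B (orbit blow-ups 3.5 + 4.25–4.28),
C (canonical strictification 7.2), each universally quantified over `G`-semi-stable pairs in the
binder conventions of the line (v7: with `Y` projective over `k`). Proof by the wave-1 worker
(boundary bookkeeping `semiStableBoundary_image_eq`, `preimage_image_eq_of_equivariant`,
`pair_conclusion_of_equivariant_modification`, p134455). [cite: DeJong1997, Prop. 5.11, pp. 618–619]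
[cite: DeJong1996, 3.2, 3.5, 4.25–4.28, 7.2, pp. 62–64, 75–76, 87–88] -/
theorem pair_semiStablePairResolution_of_blocks
    (hA : ∀ (k : Type) [Field k] (X Y : Scheme.{0}) [IsIntegral X] [IsIntegral Y] (f : X ⟶ Y)
        (q : Y ⟶ Spec (.of k)), Motives.IsProjectiveOver (Over.mk (f ≫ q)) → Motives.IsProjectiveOver (Over.mk q) → Scheme.IsRegular Y →
        ∀ (D : Set Y) (hD : IsStrictNormalCrossingsDivisor Y D) (G : Type) [Group G] [Finite G]
          (ρX : G →* Aut X) (ρY : G →* Aut Y), (∀ g : G, (ρX g).hom ≫ f = f ≫ (ρY g).hom) →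
        (∀ g : G, (ρY g).hom.base '' D = D) →
        (∀ (g : G) (C : Set Y), Maximal (fun C : Set Y => IsIrreducible C ∧ C ⊆ D) C →
                (C ∩ (ρY g).hom.base '' C).Nonempty → (ρY g).hom.base '' C = C) →
        IsSemiStableCurve f →
        (∀ x : X, (¬ ∃ U : X.Opens, x ∈ U ∧ Smooth (U.ι ≫ f)) →
                ∃ e : AdicCompletion
                    ((IsLocalRing.maximalIdeal (X.presheaf.stalk x)).map (Ideal.Quotient.mk
                      ((IsLocalRing.maximalIdeal (Y.presheaf.stalk (f.base x))).map (f.stalkMap x).hom)))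
                    (X.presheaf.stalk x ⧸
                      (IsLocalRing.maximalIdeal (Y.presheaf.stalk (f.base x))).map (f.stalkMap x).hom) ≃+*
                  MvPowerSeries (Fin 2) (Y.presheaf.stalk (f.base x) ⧸ IsLocalRing.maximalIdeal (Y.presheaf.stalk (f.base x))) ⧸
                    Ideal.span {(MvPowerSeries.X 0 * MvPowerSeries.X 1 :
                      MvPowerSeries (Fin 2) (Y.presheaf.stalk (f.base x) ⧸ IsLocalRing.maximalIdeal (Y.presheaf.stalk (f.base x))))},
                  e.toRingHom.comp ((algebraMap (X.presheaf.stalk x ⧸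
                      (IsLocalRing.maximalIdeal (Y.presheaf.stalk (f.base x))).map (f.stalkMap x).hom) _).comp
                    (Ideal.quotientMap ((IsLocalRing.maximalIdeal (Y.presheaf.stalk (f.base x))).map (f.stalkMap x).hom)
                      (f.stalkMap x).hom Ideal.le_comap_map)) =
                  algebraMap (Y.presheaf.stalk (f.base x) ⧸ IsLocalRing.maximalIdeal (Y.presheaf.stalk (f.base x))) _) →
        Smooth (f ∣_ ⟨Dᶜ, hD.isClosed.isOpen_compl⟩) →
        ∀ (m : ℕ) (τ : Fin m → (Y ⟶ X)), (∀ i : Fin m, τ i ≫ f = 𝟙 Y) →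
        (Pairwise fun i j : Fin m => Disjoint (Set.range (τ i)) (Set.range (τ j))) →
        (∀ i : Fin m, ∃ U : X.Opens, Set.range (τ i) ⊆ (U : Set X) ∧ Smooth (U.ι ≫ f)) →
        (∀ (g : G) (i : Fin m), ∃ j : Fin m, τ i ≫ (ρX g).hom = (ρY g).hom ≫ τ j) →
        ∃ (X' : Scheme.{0}) (_ : IsIntegral X') (φ : X' ⟶ X) (ρX' : G →* Aut X')
          (τ' : Fin m → (Y ⟶ X')),
          IsModification φ ∧ (∀ g : G, (ρX' g).hom ≫ φ = φ ≫ (ρX g).hom) ∧ (∀ i : Fin m, τ' i ≫ φ = τ i) ∧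
          φ.base ⁻¹' DeJong1996.semiStableBoundary f D τ = DeJong1996.semiStableBoundary (φ ≫ f) D τ' ∧
          (∀ x : X', ¬ IsRegularLocalRing (X'.presheaf.stalk x) →
              (3 : WithBot ℕ∞) ≤ ringKrullDim (X'.presheaf.stalk x)) ∧
          Motives.IsProjectiveOver (Over.mk ((φ ≫ f) ≫ q)) ∧
          IsSemiStableCurve (φ ≫ f) ∧
          (∀ x : X', (¬ ∃ U : X'.Opens, x ∈ U ∧ Smooth (U.ι ≫ (φ ≫ f))) →
                  ∃ e : AdicCompletion
                      ((IsLocalRing.maximalIdeal (X'.presheaf.stalk x)).map (Ideal.Quotient.mk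
                        ((IsLocalRing.maximalIdeal (Y.presheaf.stalk ((φ ≫ f).base x))).map ((φ ≫ f).stalkMap x).hom)))
                      (X'.presheaf.stalk x ⧸
                        (IsLocalRing.maximalIdeal (Y.presheaf.stalk ((φ ≫ f).base x))).map ((φ ≫ f).stalkMap x).hom) ≃+*
                    MvPowerSeries (Fin 2) (Y.presheaf.stalk ((φ ≫ f).base x) ⧸ IsLocalRing.maximalIdeal (Y.presheaf.stalk ((φ ≫ f).base x))) ⧸
                      Ideal.span {(MvPowerSeries.X 0 * MvPowerSeries.X 1 :
                        MvPowerSeries (Fin 2) (Y.presheaf.stalk ((φ ≫ f).base x) ⧸ IsLocalRing.maximalIdeal (Y.presheaf.stalk ((φ ≫ f).base x))))},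
                    e.toRingHom.comp ((algebraMap (X'.presheaf.stalk x ⧸
                        (IsLocalRing.maximalIdeal (Y.presheaf.stalk ((φ ≫ f).base x))).map ((φ ≫ f).stalkMap x).hom) _).comp
                      (Ideal.quotientMap ((IsLocalRing.maximalIdeal (Y.presheaf.stalk ((φ ≫ f).base x))).map ((φ ≫ f).stalkMap x).hom)
                        ((φ ≫ f).stalkMap x).hom Ideal.le_comap_map)) =
                    algebraMap (Y.presheaf.stalk ((φ ≫ f).base x) ⧸ IsLocalRing.maximalIdeal (Y.presheaf.stalk ((φ ≫ f).base x))) _) ∧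
          Smooth ((φ ≫ f) ∣_ ⟨Dᶜ, hD.isClosed.isOpen_compl⟩) ∧
          (∀ i : Fin m, ∃ U : X'.Opens, Set.range (τ' i) ⊆ (U : Set X') ∧ Smooth (U.ι ≫ (φ ≫ f))) ∧
          (∀ (g : G) (i : Fin m), ∃ j : Fin m, τ' i ≫ (ρX' g).hom = (ρY g).hom ≫ τ' j))
    (hB : ∀ (k : Type) [Field k] [PerfectField k] (X Y : Scheme.{0}) [IsIntegral X] [IsIntegral Y] (f : X ⟶ Y)
        (q : Y ⟶ Spec (.of k)), Motives.IsProjectiveOver (Over.mk (f ≫ q)) → Motives.IsProjectiveOver (Over.mk q) → Scheme.IsRegular Y →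
        ∀ (D : Set Y) (hD : IsStrictNormalCrossingsDivisor Y D) (G : Type) [Group G] [Finite G]
          (ρX : G →* Aut X) (ρY : G →* Aut Y), (∀ g : G, (ρX g).hom ≫ f = f ≫ (ρY g).hom) →
        (∀ g : G, (ρY g).hom.base '' D = D) →
        (∀ (g : G) (C : Set Y), Maximal (fun C : Set Y => IsIrreducible C ∧ C ⊆ D) C →
                (C ∩ (ρY g).hom.base '' C).Nonempty → (ρY g).hom.base '' C = C) →
        IsSemiStableCurve f →
        (∀ x : X, (¬ ∃ U : X.Opens, x ∈ U ∧ Smooth (U.ι ≫ f)) →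
                ∃ e : AdicCompletion
                    ((IsLocalRing.maximalIdeal (X.presheaf.stalk x)).map (Ideal.Quotient.mk
                      ((IsLocalRing.maximalIdeal (Y.presheaf.stalk (f.base x))).map (f.stalkMap x).hom)))
                    (X.presheaf.stalk x ⧸
                      (IsLocalRing.maximalIdeal (Y.presheaf.stalk (f.base x))).map (f.stalkMap x).hom) ≃+*
                  MvPowerSeries (Fin 2) (Y.presheaf.stalk (f.base x) ⧸ IsLocalRing.maximalIdeal (Y.presheaf.stalk (f.base x))) ⧸
                    Ideal.span {(MvPowerSeries.X 0 * MvPowerSeries.X 1 :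
                      MvPowerSeries (Fin 2) (Y.presheaf.stalk (f.base x) ⧸ IsLocalRing.maximalIdeal (Y.presheaf.stalk (f.base x))))},
                  e.toRingHom.comp ((algebraMap (X.presheaf.stalk x ⧸
                      (IsLocalRing.maximalIdeal (Y.presheaf.stalk (f.base x))).map (f.stalkMap x).hom) _).comp
                    (Ideal.quotientMap ((IsLocalRing.maximalIdeal (Y.presheaf.stalk (f.base x))).map (f.stalkMap x).hom)
                      (f.stalkMap x).hom Ideal.le_comap_map)) =
                  algebraMap (Y.presheaf.stalk (f.base x) ⧸ IsLocalRing.maximalIdeal (Y.presheaf.stalk (f.base x))) _) →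
        Smooth (f ∣_ ⟨Dᶜ, hD.isClosed.isOpen_compl⟩) →
        ∀ (m : ℕ) (τ : Fin m → (Y ⟶ X)), (∀ i : Fin m, τ i ≫ f = 𝟙 Y) →
        (Pairwise fun i j : Fin m => Disjoint (Set.range (τ i)) (Set.range (τ j))) →
        (∀ i : Fin m, ∃ U : X.Opens, Set.range (τ i) ⊆ (U : Set X) ∧ Smooth (U.ι ≫ f)) →
        (∀ (g : G) (i : Fin m), ∃ j : Fin m, τ i ≫ (ρX g).hom = (ρY g).hom ≫ τ j) →
        (∀ x : X, ¬ IsRegularLocalRing (X.presheaf.stalk x) →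
            (3 : WithBot ℕ∞) ≤ ringKrullDim (X.presheaf.stalk x)) →
        ∃ (X' : Scheme.{0}) (_ : IsIntegral X') (ψ : X' ⟶ X) (ρX' : G →* Aut X'),
          IsModification ψ ∧ (∀ g : G, (ρX' g).hom ≫ ψ = ψ ≫ (ρX g).hom) ∧
          Motives.IsProjectiveOver (Over.mk ((ψ ≫ f) ≫ q)) ∧ Scheme.IsRegular X' ∧
          IsNormalCrossingsDivisor X' (ψ.base ⁻¹' DeJong1996.semiStableBoundary f D τ))
    (hC : ∀ (k : Type) [Field k] (S : Scheme.{0}) [IsIntegral S] (p : S ⟶ Spec (.of k)),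
        Motives.IsProjectiveOver (Over.mk p) → Scheme.IsRegular S →
        ∀ (G : Type) [Group G] [Finite G] (ρ : G →* Aut S) (E : Set S), IsNormalCrossingsDivisor S E →
          (∀ g : G, (ρ g).hom.base '' E = E) →
          ∃ (S' : Scheme.{0}) (_ : IsIntegral S') (b : S' ⟶ S) (ρ' : G →* Aut S'),
            IsModification b ∧ (∀ g : G, (ρ' g).hom ≫ b = b ≫ (ρ g).hom) ∧
            Motives.IsProjectiveOver (Over.mk (b ≫ p)) ∧ Scheme.IsRegular S' ∧
            IsStrictNormalCrossingsDivisor S' (b.base ⁻¹' E) ∧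
            (∀ (g : G) (C : Set S'), Maximal (fun C : Set S' => IsIrreducible C ∧ C ⊆ b.base ⁻¹' E) C →
              (C ∩ (ρ' g).hom.base '' C).Nonempty → (ρ' g).hom.base '' C = C))
    (k : Type) [Field k] [PerfectField k] (X Y : Scheme.{0}) [IsIntegral X] [IsIntegral Y]
    (f : X ⟶ Y) (q : Y ⟶ Spec (.of k))
    (hprojX : Motives.IsProjectiveOver (Over.mk (f ≫ q))) (hprojY : Motives.IsProjectiveOver (Over.mk q)) (hreg : Scheme.IsRegular Y)
    (D : Set Y) (hD : IsStrictNormalCrossingsDivisor Y D)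
    (G : Type) [Group G] [Finite G] (ρX : G →* Aut X) (ρY : G →* Aut Y)
    (hρf : (∀ g : G, (ρX g).hom ≫ f = f ≫ (ρY g).hom))
    (hDG : (∀ g : G, (ρY g).hom.base '' D = D))
    (hDstrict : (∀ (g : G) (C : Set Y), Maximal (fun C : Set Y => IsIrreducible C ∧ C ⊆ D) C →
        (C ∩ (ρY g).hom.base '' C).Nonempty → (ρY g).hom.base '' C = C))
    (hss : IsSemiStableCurve f)
    (hqs : (∀ x : X, (¬ ∃ U : X.Opens, x ∈ U ∧ Smooth (U.ι ≫ f)) →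
        ∃ e : AdicCompletion
            ((IsLocalRing.maximalIdeal (X.presheaf.stalk x)).map (Ideal.Quotient.mk
              ((IsLocalRing.maximalIdeal (Y.presheaf.stalk (f.base x))).map (f.stalkMap x).hom)))
            (X.presheaf.stalk x ⧸
              (IsLocalRing.maximalIdeal (Y.presheaf.stalk (f.base x))).map (f.stalkMap x).hom) ≃+*
          MvPowerSeries (Fin 2) (Y.presheaf.stalk (f.base x) ⧸ IsLocalRing.maximalIdeal (Y.presheaf.stalk (f.base x))) ⧸
            Ideal.span {(MvPowerSeries.X 0 * MvPowerSeries.X 1 :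
              MvPowerSeries (Fin 2) (Y.presheaf.stalk (f.base x) ⧸ IsLocalRing.maximalIdeal (Y.presheaf.stalk (f.base x))))},
          e.toRingHom.comp ((algebraMap (X.presheaf.stalk x ⧸
              (IsLocalRing.maximalIdeal (Y.presheaf.stalk (f.base x))).map (f.stalkMap x).hom) _).comp
            (Ideal.quotientMap ((IsLocalRing.maximalIdeal (Y.presheaf.stalk (f.base x))).map (f.stalkMap x).hom)
              (f.stalkMap x).hom Ideal.le_comap_map)) =
          algebraMap (Y.presheaf.stalk (f.base x) ⧸ IsLocalRing.maximalIdeal (Y.presheaf.stalk (f.base x))) _))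
    (hsm : Smooth (f ∣_ ⟨Dᶜ, hD.isClosed.isOpen_compl⟩))
    (m : ℕ) (τ : Fin m → (Y ⟶ X)) (hτf : (∀ i : Fin m, τ i ≫ f = 𝟙 Y))
    (hτdisj : (Pairwise fun i j : Fin m => Disjoint (Set.range (τ i)) (Set.range (τ j))))
    (hτsm : (∀ i : Fin m, ∃ U : X.Opens, Set.range (τ i) ⊆ (U : Set X) ∧ Smooth (U.ι ≫ f)))
    (hτG : (∀ (g : G) (i : Fin m), ∃ j : Fin m, τ i ≫ (ρX g).hom = (ρY g).hom ≫ τ j)) :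
    ∃ (G₁ : Type) (_ : Group G₁) (_ : Finite G₁) (X₁ : Scheme.{0}) (_ : IsIntegral X₁)
      (ρ₁ : G₁ →* Aut X₁) (φ₁ : G₁ →* G) (π₁ : X₁ ⟶ X) (_ : IsDominant π₁),
      Function.Surjective φ₁ ∧ IsAlteration π₁ ∧ Scheme.IsRegular X₁ ∧
      Motives.IsProjectiveOver (Over.mk (π₁ ≫ f ≫ q)) ∧
      (∀ g : G₁, (ρ₁ g).hom ≫ π₁ = π₁ ≫ (ρX (φ₁ g)).hom) ∧
      (∀ a : X₁.functionField, (∀ g : G₁, RatFn.functionFieldMap (ρ₁ g).hom a = a) →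
        ∃ (n : ℕ) (c : X.functionField), (∀ g : G, RatFn.functionFieldMap (ρX g).hom c = c) ∧
          a ^ ringExpChar X.functionField ^ n = RatFn.functionFieldMap π₁ c) ∧
      ∃ D₁ : Set X₁, IsStrictNormalCrossingsDivisor X₁ D₁ ∧ π₁.base ⁻¹' (DeJong1996.semiStableBoundary f D τ) ⊆ D₁ ∧
        (∀ g : G₁, (ρ₁ g).hom.base '' D₁ = D₁) ∧
        (∀ (g : G₁) (C : Set X₁), Maximal (fun C : Set X₁ => IsIrreducible C ∧ C ⊆ D₁) C →
          (C ∩ (ρ₁ g).hom.base '' C).Nonempty → (ρ₁ g).hom.base '' C = C) := by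
  -- (A): equivariant Lemma 3.2 — reach `codim(Sing X', X') ≥ 3` keeping the `G`-semi-stable pair
  obtain ⟨X', _, φ, ρX', τ', hφ, hφG, hττ', hZ', hcodim', hprojX', hss', hqs', hsm', hτsm', hτG'⟩ :=
    hA k X Y f q hprojX hprojY hreg D hD G ρX ρY hρf hDG hDstrict hss hqs hsm m τ hτf hτdisj hτsm hτG
  -- the formal consequences for the pair `(X', φ ≫ f, τ')`
  have hρf' : ∀ g : G, (ρX' g).hom ≫ (φ ≫ f) = (φ ≫ f) ≫ (ρY g).hom := fun g => by
    rw [← Category.assoc, hφG g, Category.assoc, hρf g, Category.assoc]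
  have hτf' : ∀ i : Fin m, τ' i ≫ (φ ≫ f) = 𝟙 Y := fun i => by
    rw [← Category.assoc, hττ' i, hτf i]
  have hτdisj' : Pairwise fun i j : Fin m => Disjoint (Set.range (τ' i)) (Set.range (τ' j)) := by
    intro i j hij
    refine Set.disjoint_left.mpr ?_
    rintro _ ⟨y, rfl⟩ ⟨y', hy'⟩
    have h1 : (τ j ≫ 𝟙 X).base y' = (τ i ≫ 𝟙 X).base y := by
      rw [← hττ' j, ← hττ' i, Scheme.Hom.comp_apply, Scheme.Hom.comp_apply]
      exact congrArg (fun x => φ.base x) hy'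
    simp only [Category.comp_id] at h1
    exact Set.disjoint_left.mp (hτdisj hij) ⟨y, rfl⟩ ⟨y', h1⟩
  -- (B): blow up the `G`-orbits of the components of `Sing X'`
  obtain ⟨X'', _, ψ, ρX'', hψ, hψG, hprojX'', hreg'', hncd⟩ :=
    hB k X' Y (φ ≫ f) q hprojX' hprojY hreg D hD G ρX' ρY hρf' hDG hDstrict hss' hqs' hsm' m τ' hτf'
      hτdisj' hτsm' hτG' hcodim'
  -- the boundary `Z'` of `(X', φ ≫ f, τ')` is `G`-stable, hence so is `E = ψ⁻¹ Z'`
  have hZ'G := semiStableBoundary_image_eq (φ ≫ f) D τ' ρX' ρY hρf' hDG hτG'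
  have hEG := preimage_image_eq_of_equivariant ψ ρX'' ρX' hψG _ hZ'G
  -- (C): the canonical blow-up of de Jong 1996, 7.2
  obtain ⟨X₁, _, b, ρ₁, hb, hbG, hproj₁, hreg₁, hsnc, hstrict⟩ :=
    hC k X'' _ hprojX'' hreg'' G ρX'' _ hncd hEG
  -- assemble `π₁ := b ≫ ψ ≫ φ`
  refine pair_conclusion_of_equivariant_modification k (f ≫ q) (DeJong1996.semiStableBoundary f D τ)
    G ρX X₁ (b ≫ ψ ≫ φ) (hb.comp (hψ.comp hφ)) ρ₁ (fun g => ?_) hreg₁ ?_ _ hsnc ?_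
    (preimage_image_eq_of_equivariant b ρ₁ ρX'' hbG _ hEG) hstrict
  · -- equivariance composes
    rw [reassoc_of% (hbG g), reassoc_of% (hψG g), Category.assoc, Category.assoc, hφG g]
  · -- projectivity of `X₁` over `k`
    simpa only [Category.assoc] using hproj₁
  · -- `π₁⁻¹ Z = b⁻¹ ψ⁻¹ φ⁻¹ Z = b⁻¹ ψ⁻¹ Z'`
    intro x hx
    show ψ.base (b.base x) ∈ DeJong1996.semiStableBoundary (φ ≫ f) D τ'
    rw [← hZ']
    simpa only [Set.mem_preimage, Scheme.Hom.comp_apply] using hx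

/-- **De Jong 1997, Prop. 5.11 in the pair format** (v5's `stub_pair_semiStablePairResolution`, with
`hprojY`; over a perfect field since v8), PROVED from A (`pair_ssCodimThree`, modulo C1–C3), B (`pair_ssOrbitBlowup`, modulo N, S) and the LANDED C
(`stub_pair_canonicalStrictification`, p136673). [cite: DeJong1997, Prop. 5.11, pp. 618–619] -/
theorem pair_semiStablePairResolution (k : Type) [Field k] [PerfectField k] (X Y : Scheme.{0}) [IsIntegral X] [IsIntegral Y]
    (f : X ⟶ Y) (q : Y ⟶ Spec (.of k))
    (hprojX : Motives.IsProjectiveOver (Over.mk (f ≫ q))) (hprojY : Motives.IsProjectiveOver (Over.mk q)) (hreg : Scheme.IsRegular Y)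
    (D : Set Y) (hD : IsStrictNormalCrossingsDivisor Y D)
    (G : Type) [Group G] [Finite G] (ρX : G →* Aut X) (ρY : G →* Aut Y)
    (hρf : (∀ g : G, (ρX g).hom ≫ f = f ≫ (ρY g).hom))
    (hDG : (∀ g : G, (ρY g).hom.base '' D = D))
    (hDstrict : (∀ (g : G) (C : Set Y), Maximal (fun C : Set Y => IsIrreducible C ∧ C ⊆ D) C →
        (C ∩ (ρY g).hom.base '' C).Nonempty → (ρY g).hom.base '' C = C))
    (hss : IsSemiStableCurve f)
    (hqs : (∀ x : X, (¬ ∃ U : X.Opens, x ∈ U ∧ Smooth (U.ι ≫ f)) →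
        ∃ e : AdicCompletion
            ((IsLocalRing.maximalIdeal (X.presheaf.stalk x)).map (Ideal.Quotient.mk
              ((IsLocalRing.maximalIdeal (Y.presheaf.stalk (f.base x))).map (f.stalkMap x).hom)))
            (X.presheaf.stalk x ⧸
              (IsLocalRing.maximalIdeal (Y.presheaf.stalk (f.base x))).map (f.stalkMap x).hom) ≃+*
          MvPowerSeries (Fin 2) (Y.presheaf.stalk (f.base x) ⧸ IsLocalRing.maximalIdeal (Y.presheaf.stalk (f.base x))) ⧸
            Ideal.span {(MvPowerSeries.X 0 * MvPowerSeries.X 1 :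
              MvPowerSeries (Fin 2) (Y.presheaf.stalk (f.base x) ⧸ IsLocalRing.maximalIdeal (Y.presheaf.stalk (f.base x))))},
          e.toRingHom.comp ((algebraMap (X.presheaf.stalk x ⧸
              (IsLocalRing.maximalIdeal (Y.presheaf.stalk (f.base x))).map (f.stalkMap x).hom) _).comp
            (Ideal.quotientMap ((IsLocalRing.maximalIdeal (Y.presheaf.stalk (f.base x))).map (f.stalkMap x).hom)
              (f.stalkMap x).hom Ideal.le_comap_map)) =
          algebraMap (Y.presheaf.stalk (f.base x) ⧸ IsLocalRing.maximalIdeal (Y.presheaf.stalk (f.base x))) _))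
    (hsm : Smooth (f ∣_ ⟨Dᶜ, hD.isClosed.isOpen_compl⟩))
    (m : ℕ) (τ : Fin m → (Y ⟶ X)) (hτf : (∀ i : Fin m, τ i ≫ f = 𝟙 Y))
    (hτdisj : (Pairwise fun i j : Fin m => Disjoint (Set.range (τ i)) (Set.range (τ j))))
    (hτsm : (∀ i : Fin m, ∃ U : X.Opens, Set.range (τ i) ⊆ (U : Set X) ∧ Smooth (U.ι ≫ f)))
    (hτG : (∀ (g : G) (i : Fin m), ∃ j : Fin m, τ i ≫ (ρX g).hom = (ρY g).hom ≫ τ j)) :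
    ∃ (G₁ : Type) (_ : Group G₁) (_ : Finite G₁) (X₁ : Scheme.{0}) (_ : IsIntegral X₁)
      (ρ₁ : G₁ →* Aut X₁) (φ₁ : G₁ →* G) (π₁ : X₁ ⟶ X) (_ : IsDominant π₁),
      Function.Surjective φ₁ ∧ IsAlteration π₁ ∧ Scheme.IsRegular X₁ ∧
      Motives.IsProjectiveOver (Over.mk (π₁ ≫ f ≫ q)) ∧
      (∀ g : G₁, (ρ₁ g).hom ≫ π₁ = π₁ ≫ (ρX (φ₁ g)).hom) ∧
      (∀ a : X₁.functionField, (∀ g : G₁, RatFn.functionFieldMap (ρ₁ g).hom a = a) →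
        ∃ (n : ℕ) (c : X.functionField), (∀ g : G, RatFn.functionFieldMap (ρX g).hom c = c) ∧
          a ^ ringExpChar X.functionField ^ n = RatFn.functionFieldMap π₁ c) ∧
      ∃ D₁ : Set X₁, IsStrictNormalCrossingsDivisor X₁ D₁ ∧ π₁.base ⁻¹' (DeJong1996.semiStableBoundary f D τ) ⊆ D₁ ∧
        (∀ g : G₁, (ρ₁ g).hom.base '' D₁ = D₁) ∧
        (∀ (g : G₁) (C : Set X₁), Maximal (fun C : Set X₁ => IsIrreducible C ∧ C ⊆ D₁) C →
          (C ∩ (ρ₁ g).hom.base '' C).Nonempty → (ρ₁ g).hom.base '' C = C) :=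
  pair_semiStablePairResolution_of_blocks pair_ssCodimThree pair_ssOrbitBlowup
    stub_pair_canonicalStrictification k X Y f q hprojX hprojY hreg D hD G ρX ρY hρf hDG hDstrict
    hss hqs hsm m τ hτf hτdisj hτsm hτG

/-! ## The induction on `dim X` (proved, v5; `hprojY` threaded in v7) -/

/-- **De Jong's equivariant alteration theorem in pair format, for projective `G`-varieties of
dimension `≤ d` over a perfect field** — by induction on `d`; base case `stub_pair_dimZero`
(LANDED p133912), step = `pair_reductionToSemiStablePair` + `pair_semiStablePairResolution` +
`stub_pair_transport` (LANDED p133983). [cite: DeJong1997, Thm. 5.13, pp. 619–620]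
[cite: DeJong1996, Thm. 7.3, p. 88] -/
theorem pair_statementUpToDim (k : Type) [Field k] [PerfectField k] (d : ℕ) :
    ∀ (X : Scheme.{0}) [IsIntegral X] (f : X ⟶ Spec (.of k)),
      Motives.IsProjectiveOver (Over.mk f) →
      ∀ (G : Type) [Group G] [Finite G] (ρ : G →* Aut X), (∀ g : G, (ρ g).hom ≫ f = f) →
      ∀ (Z : Set X), IsClosed Z → Z ≠ Set.univ → (∀ g : G, (ρ g).hom.base '' Z ⊆ Z) →
      topologicalKrullDim X ≤ (d : ℕ) →
      ∃ (G₁ : Type) (_ : Group G₁) (_ : Finite G₁) (X₁ : Scheme.{0}) (_ : IsIntegral X₁)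
        (ρ₁ : G₁ →* Aut X₁) (φ₁ : G₁ →* G) (π₁ : X₁ ⟶ X) (_ : IsDominant π₁),
        Function.Surjective φ₁ ∧ IsAlteration π₁ ∧ Scheme.IsRegular X₁ ∧
        Motives.IsProjectiveOver (Over.mk (π₁ ≫ f)) ∧
        (∀ g : G₁, (ρ₁ g).hom ≫ π₁ = π₁ ≫ (ρ (φ₁ g)).hom) ∧
        (∀ a : X₁.functionField, (∀ g : G₁, RatFn.functionFieldMap (ρ₁ g).hom a = a) →
          ∃ (n : ℕ) (c : X.functionField), (∀ g : G, RatFn.functionFieldMap (ρ g).hom c = c) ∧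
            a ^ ringExpChar X.functionField ^ n = RatFn.functionFieldMap π₁ c) ∧
        ∃ D₁ : Set X₁, IsStrictNormalCrossingsDivisor X₁ D₁ ∧ π₁.base ⁻¹' (Z) ⊆ D₁ ∧
          (∀ g : G₁, (ρ₁ g).hom.base '' D₁ = D₁) ∧
          (∀ (g : G₁) (C : Set X₁), Maximal (fun C : Set X₁ => IsIrreducible C ∧ C ⊆ D₁) C →
            (C ∩ (ρ₁ g).hom.base '' C).Nonempty → (ρ₁ g).hom.base '' C = C) := by
  induction d with
  | zero =>
    intro X _ f hproj G _ _ ρ _ Z _ hZne _ hdim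
    exact stub_pair_dimZero k X f hproj G ρ Z hZne hdim
  | succ d ih =>
    intro X _ f hproj G _ _ ρ hρ Z hZ hZne hZG hdim
    by_cases hle : topologicalKrullDim X ≤ (d : ℕ)
    · exact ih X f hproj G ρ hρ Z hZ hZne hZG hle
    · obtain ⟨G', _, _, X', Y', _, _, f', q', ρX', ρY', D', hD', m, τ, hprojX, hprojY, hreg, hDG, hDstrict, hss, hqs, hsm, hτf, hτdisj, hτsm, hρf, hτG,
        φ', π', _, hφ', hπ', hcomm, hequiv, hgal, hZZ'⟩ :=
        pair_reductionToSemiStablePair k d ih X f hproj G ρ hρ Z hZ hZne hZG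
          (WithBot.ENat.eq_succ_of_le_succ_of_not_le hdim hle)
      have hres := pair_semiStablePairResolution k X' Y' f' q' hprojX hprojY hreg D' hD' G' ρX' ρY'
        hρf hDG hDstrict hss hqs hsm m τ hτf hτdisj hτsm hτG
      rw [hcomm] at hres
      exact stub_pair_transport k X f G ρ Z X' G' ρX' φ' π' hφ' hπ' hequiv hgal _ hZZ' hres

/-! ## The pair statement of skeleton v4, a theorem since v5 -/

/-- **De Jong's equivariant alteration theorem over a PERFECT field, in Galois-alteration form
with boundary** (= skeleton v4's `stub_deJong1997_pair_perfect`, verbatim signature) = de Jong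
1996, Thm. 7.3 (stated there over an algebraically closed field) = de Jong 1997, (5.12.1) for the
pair `(X, G)` over `S = Spec k` (Thm. 5.13 with Cor. 5.15's reduction), restricted to NORMAL
PROJECTIVE `X`: from `pair_statementUpToDim` at `d = dim X` (a variety is finite-dimensional,
`exists_topologicalKrullDim_le_of_locallyOfFiniteType`). The normality, characteristic and
separatedness hypotheses are not used (kept for the signature registered in v4).
[cite: DeJong1996, Thm. 7.3 and 7.1, p. 88] [cite: DeJong1997, (5.12.1), Thm. 5.13, Cor. 5.15, pp. 619–620] -/
theorem deJong1997_pair_perfect (p : ℕ) (_hp : p.Prime) (k : Type) [Field k]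
    [CharP k p] [PerfectField k] (X : Scheme.{0}) [IsIntegral X] (f : X ⟶ Spec (.of k))
    (_hs : IsSeparated f) (hl : LocallyOfFiniteType f) (hq : QuasiCompact f)
    (_hN : ∀ x : X, IsIntegrallyClosed (X.presheaf.stalk x))
    (hproj : Motives.IsProjectiveOver (Over.mk f))
    (G : Type) [Group G] [Finite G] (ρ : G →* Aut X) (hρ : ∀ g : G, (ρ g).hom ≫ f = f)
    (Z : Set X) (hZ : IsClosed Z) (hZne : Z ≠ Set.univ)
    (hZG : ∀ g : G, (ρ g).hom.base '' Z ⊆ Z) :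
    ∃ (G₁ : Type) (_ : Group G₁) (_ : Finite G₁) (X₁ : Scheme.{0}) (_ : IsIntegral X₁)
      (ρ₁ : G₁ →* Aut X₁) (φ₁ : G₁ →* G) (π₁ : X₁ ⟶ X) (_ : IsDominant π₁),
      Function.Surjective φ₁ ∧ IsAlteration π₁ ∧ Scheme.IsRegular X₁ ∧
      Motives.IsProjectiveOver (Over.mk (π₁ ≫ f)) ∧
      (∀ g : G₁, (ρ₁ g).hom ≫ π₁ = π₁ ≫ (ρ (φ₁ g)).hom) ∧
      (∀ a : X₁.functionField, (∀ g : G₁, RatFn.functionFieldMap (ρ₁ g).hom a = a) →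
        ∃ (n : ℕ) (c : X.functionField), (∀ g : G, RatFn.functionFieldMap (ρ g).hom c = c) ∧
          a ^ ringExpChar X.functionField ^ n = RatFn.functionFieldMap π₁ c) ∧
      ∃ D₁ : Set X₁, IsStrictNormalCrossingsDivisor X₁ D₁ ∧ π₁.base ⁻¹' (Z) ⊆ D₁ ∧
        (∀ g : G₁, (ρ₁ g).hom.base '' D₁ = D₁) ∧
        (∀ (g : G₁) (C : Set X₁), Maximal (fun C : Set X₁ => IsIrreducible C ∧ C ⊆ D₁) C →
          (C ∩ (ρ₁ g).hom.base '' C).Nonempty → (ρ₁ g).hom.base '' C = C) := by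
  haveI := hl
  haveI : CompactSpace X := (HasAffineProperty.iff_of_isAffine (P := @QuasiCompact)).mp hq
  obtain ⟨d, hd⟩ := exists_topologicalKrullDim_le_of_locallyOfFiniteType f
  exact pair_statementUpToDim k d X f hproj G ρ hρ Z hZ hZne hZG hd

/-- **The datum of skeletons v2/v3 from the pair format** (glue, proved): apply the held stub to
the pair `(X, 1)` with `Z = ∅`, forget the divisor, pass to the faithful image
`ρ₁.range ≤ Aut X₁` of the group (de Jong 1997, 5.3) and read "finite subsets lie in affine
opens" off the projectivity of `X₁` (graded prime avoidance,
`IsProjectiveOver.finiteSubsetsInAffineOpens`). [cite: DeJong1997, 5.3 and Cor. 5.15, pp. 613, 620] -/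
theorem deJong1997_galoisAlteration_perfect_of_pair (p : ℕ) (hp : p.Prime) (k : Type) [Field k]
    [CharP k p] [PerfectField k] (X : Scheme.{0}) [IsIntegral X] (f : X ⟶ Spec (.of k))
    (hs : IsSeparated f) (hl : LocallyOfFiniteType f) (hq : QuasiCompact f)
    (hN : ∀ x : X, IsIntegrallyClosed (X.presheaf.stalk x))
    (hproj : Motives.IsProjectiveOver (Over.mk f)) :
    ∃ (G : Type) (_ : Group G) (_ : Finite G) (X₁ : Scheme.{0}) (_ : IsIntegral X₁)
      (ρ : G →* Aut X₁) (π : X₁ ⟶ X) (_ : IsDominant π),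
      IsAlteration π ∧ Scheme.IsRegular X₁ ∧ Function.Injective ρ ∧
      (∀ g : G, (ρ g).hom ≫ π = π) ∧
      (∀ S : Finset X₁, ∃ U : X₁.Opens, IsAffineOpen U ∧ (↑S : Set X₁) ⊆ U) ∧
      (∀ a : X₁.functionField, (∀ g : G, RatFn.functionFieldMap (ρ g).hom a = a) →
        ∃ n : ℕ, a ^ ringExpChar X.functionField ^ n ∈ Set.range (RatFn.functionFieldMap π)) := by
  have hZne : (∅ : Set X) ≠ Set.univ := fun h =>
    Set.not_nonempty_empty (h ▸ Set.univ_nonempty)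
  obtain ⟨G₁, _, _, X₁, _, ρ₁, φ, π, _, -, hπ, hreg, hproj₁, hequiv, hd, -⟩ :=
    deJong1997_pair_perfect p hp k X f hs hl hq hN hproj PUnit 1 (fun _ => by
      rw [show ((1 : PUnit →* Aut X) _).hom = 𝟙 X from rfl, Category.id_comp]) ∅ isClosed_empty
      hZne (fun _ => by rw [Set.image_empty])
  -- invariance of `π` (the group downstairs is trivial)
  have hinv : ∀ g : G₁, (ρ₁ g).hom ≫ π = π := fun g => by
    rw [hequiv g, show ((1 : PUnit →* Aut X) (φ g)).hom = 𝟙 X from rfl, Category.comp_id]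
  -- finite subsets of the projective `X₁` lie in affine opens
  have hAF : ∀ S : Finset X₁, ∃ U : X₁.Opens, IsAffineOpen U ∧ (↑S : Set X₁) ⊆ U := by
    intro S
    obtain ⟨W, hW, hmem⟩ := hproj₁.finiteSubsetsInAffineOpens.exists_open S
    have hW' : IsAffineHom (W.ι ≫ π ≫ f) := hW
    exact ⟨W, @isAffine_of_isAffineHom _ _ (W.ι ≫ π ≫ f) hW' inferInstance, fun t ht => hmem t ht⟩
  -- faithful image of the group
  haveI : Finite ρ₁.range := Finite.of_surjective _ ρ₁.rangeRestrict_surjective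
  refine ⟨ρ₁.range, inferInstance, inferInstance, X₁, inferInstance, ρ₁.range.subtype, π,
    inferInstance, hπ, hreg, ρ₁.range.subtype_injective, ?_, hAF, fun a ha => ?_⟩
  · rintro ⟨_, g, rfl⟩
    exact hinv g
  · obtain ⟨n, c, -, hc⟩ := hd a fun g => ha ⟨ρ₁ g, g, rfl⟩
    exact ⟨n, c, hc.symm⟩

/-! ## Glue 1: the Galois-type quotient presentation from de Jong's Galois alteration -/

/-- The characteristic of the function field of a variety over a field of characteristic `p`.
[folklore] -/
theorem charP_functionField_of_over {p : ℕ} {k : Type} [Field k] [CharP k p] {X : Scheme.{0}}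
    [IsIntegral X] (f : X ⟶ Spec (.of k)) : CharP X.functionField p := by
  let ι : k →+* X.functionField :=
    (X.presheaf.germ ⊤ (genericPoint X) trivial).hom.comp
      (f.appTop.hom.comp (Scheme.ΓSpecIso (.of k)).inv.hom)
  exact (ι.charP_iff_charP p).mp ‹_›

/-- **The Galois-type quotient presentation** (de Jong 1997 Thm. 5.13 / Cor. 5.15 + SGA 1 V.1 +
Abramovich–Oort 2000 Cor. 2.9), at a field `k` of characteristic `p`, from de Jong's Galois
alteration with regular quasi-projective source and faithful group at `k`: the body of the support
`WildQuotients.GaloisQuotientAlteration` at `(p, k, X)`. [cite: DeJong1997, Cor. 5.15]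
[cite: AbramovichOort2000, Cor. 2.9] -/
theorem galoisQuotientAlterationAt_of_deJong {p : ℕ} (hp : p.Prime) {k : Type} [Field k]
    [CharP k p] (X : Scheme.{0}) (f : X ⟶ Spec (.of k)) [IsSeparated f] [LocallyOfFiniteType f]
    [QuasiCompact f] [IsIntegral X]
    (hdJ : ∃ (G : Type) (_ : Group G) (_ : Finite G) (X₁ : Scheme.{0}) (_ : IsIntegral X₁)
      (ρ : G →* Aut X₁) (π : X₁ ⟶ X) (_ : IsDominant π),
      IsAlteration π ∧ Scheme.IsRegular X₁ ∧ Function.Injective ρ ∧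
      (∀ g : G, (ρ g).hom ≫ π = π) ∧
      (∀ S : Finset X₁, ∃ U : X₁.Opens, IsAffineOpen U ∧ (↑S : Set X₁) ⊆ U) ∧
      (∀ a : X₁.functionField, (∀ g : G, RatFn.functionFieldMap (ρ g).hom a = a) →
        ∃ n : ℕ, a ^ ringExpChar X.functionField ^ n ∈ Set.range (RatFn.functionFieldMap π))) :
    ∃ (X' X₁ : Scheme.{0}) (q : X' ⟶ X₁) (φ : X₁ ⟶ X) (G : Type) (_ : Group G) (_ : Finite G)
        (ρ : G →* Aut X'), IsSeparated (φ ≫ f) ∧ LocallyOfFiniteType (φ ≫ f) ∧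
        QuasiCompact (φ ≫ f) ∧ IsIntegral X₁ ∧ IsIntegral X' ∧ Scheme.IsRegular X' ∧ IsFinite q ∧
        Function.Surjective q.base ∧ (∃ U : X₁.Opens, Dense (U : Set X₁) ∧ Etale (q ∣_ U)) ∧
        (∀ g : G, (ρ g).hom ≫ q = q) ∧ (∀ x y : X', q.base x = q.base y → ∃ g : G,
          (ρ g).hom.base x = y) ∧ IsProper φ ∧ Function.Surjective φ.base ∧
        ∃ V : X.Opens, Dense (V : Set X) ∧ IsFinite (φ ∣_ V) ∧ UniversallyInjective (φ ∣_ V) := by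
  -- adapted from `Theorems/WildQuotientsGaloisQuotientAlteration.lean`
  -- (`galoisQuotientAlteration_of_deJong1997`, stmt-16323), with the de Jong hypothesis localised
  -- at `(k, X)`
  classical
  haveI : Fact p.Prime := ⟨hp⟩
  obtain ⟨G, _, _, X', _, ρ, π, _, hπ, hreg, hρinj, hinv, hfinaff, hd⟩ := hdJ
  haveI : Fintype G := Fintype.ofFinite G
  haveI := hπ.isProper
  haveI : Surjective π := hπ.surjective
  haveI : X.IsSeparated := ⟨by rw [← terminal.comp_from f]; infer_instance⟩
  -- the action over `Spec k` and the covering by `G`-stable affine opens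
  let r : X' ⟶ Spec (.of k) := π ≫ f
  let ρA : ActionOver r G := ⟨ρ, fun g => by rw [← Category.assoc, hinv g]⟩
  haveI : IsSeparated r := inferInstanceAs (IsSeparated (π ≫ f))
  haveI : LocallyOfFiniteType r := inferInstanceAs (LocallyOfFiniteType (π ≫ f))
  haveI : QuasiCompact r := inferInstanceAs (QuasiCompact (π ≫ f))
  haveI : X'.IsSeparated := ⟨by rw [← terminal.comp_from r]; infer_instance⟩
  have hcov : ∀ x : X', ∃ O : ρA.StableAffineOpens, x ∈ O.1 := by
    intro x
    obtain ⟨U, hU, hS⟩ := hfinaff (Finset.univ.image fun g : G => (ρ g).hom x)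
    obtain ⟨O, hx, -⟩ := ρA.exists_stableAffineOpen_le_of_orbit x U hU fun g => hS (by
      simp only [Finset.coe_image, Finset.coe_univ, Set.image_univ, Set.mem_range]
      exact ⟨g, rfl⟩)
    exact ⟨O, hx⟩
  -- the quotient `X₁ := X'/G`, `q : X' → X₁`, `φ : X₁ → X`
  have hinv' : ∀ g : G, (ρA.aut g).hom ≫ π = π := hinv
  let q : X' ⟶ ρA.glued := ρA.gluedMk hcov
  let φ : ρA.glued ⟶ X := ρA.gluedDesc π hinv'
  have hqφ : q ≫ φ = π := ρA.gluedMk_gluedDesc hcov π hinv'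
  have hφf : φ ≫ f = ρA.gluedDesc r ρA.aut_comp :=
    ρA.glued_hom_ext hcov (by rw [ρA.gluedMk_gluedDesc_assoc, ρA.gluedMk_gluedDesc])
  haveI : IsIntegral ρA.glued := ρA.isIntegral_glued hcov
  haveI : IsProper φ := ρA.isProper_gluedDesc hcov π hinv' f rfl
  haveI : Surjective φ := ρA.surjective_gluedDesc hcov π hinv'
  haveI : IsFinite q := ρA.isFinite_gluedMk hcov
  haveI : IsSeparated φ := inferInstance
  -- characteristic `p` of `K(X)`
  haveI : CharP X.functionField p := charP_functionField_of_over f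
  haveI : ExpChar X.functionField p := ExpChar.prime hp
  refine ⟨X', ρA.glued, q, φ, G, inferInstance, inferInstance, ρ, ?_, ?_, ?_, inferInstance,
    inferInstance, hreg, inferInstance, ρA.gluedMk_surjective hcov, ?_, ρA.aut_hom_gluedMk hcov,
    fun x y hxy => ρA.exists_aut_apply_eq_of_gluedMk_eq hcov hxy, inferInstance,
    Scheme.Hom.surjective φ, ?_⟩
  · -- separated over `k`
    infer_instance
  · -- locally of finite type over `k` (E. Noether)
    rw [hφf]; exact ρA.locallyOfFiniteType_gluedDesc_base
  · -- quasi-compact over `k`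
    rw [hφf]; exact ρA.quasiCompact_gluedDesc_base hcov
  · -- `q` is étale over a dense open: the action is faithful on `K(X')`
    have hfaith : ∀ g : G, g ≠ 1 → RatFn.functionFieldMap (ρA.aut g).hom ≠ RingHom.id _ :=
      ρA.functionFieldMap_ne_id_of_injective hρinj
    obtain ⟨U, hUne, hU⟩ := ρA.exists_etale_morphismRestrict_gluedMk hcov hfaith
    exact ⟨U, U.isOpen.dense hUne, hU⟩
  · -- `φ` is finite and universally injective over a dense open
    -- (1) finite over a neighbourhood of the generic point `η`: the fibre of `φ` over `η` is finite
    obtain ⟨U₀, hU₀ne, hU₀fin⟩ := hπ.exists_isFinite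
    haveI := hU₀fin
    have hη₀ : genericPoint X ∈ U₀ :=
      ((genericPoint_spec X).mem_open_set_iff U₀.isOpen).mpr (by simpa using hU₀ne)
    have hfib : (φ ⁻¹' {genericPoint X}).Finite := by
      refine ((finite_preimage_singleton_of_isFinite_morphismRestrict π U₀ hη₀).image q).subset ?_
      intro y hy
      obtain ⟨x, rfl⟩ := ρA.gluedMk_surjective hcov y
      refine ⟨x, ?_, rfl⟩
      change π x = genericPoint X
      rw [← hqφ]
      exact hy
    obtain ⟨V₀, hηV₀, hV₀fin⟩ :=
      exists_isFinite_morphismRestrict_of_finite_preimage_singleton φ (genericPoint X) hfib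
    obtain ⟨V₁, hV₁aff, hηV₁, hV₁V₀⟩ := exists_isAffineOpen_mem_and_subset hηV₀
    haveI : IsFinite (φ ∣_ V₁) := morphismRestrict_of_le φ (fun x hx => hV₁V₀ hx) hV₀fin
    -- (2) `K(X₁)/K(X)` is purely inseparable: `K(X₁) ⊆ K(X')^G` via `q♯`, and (d)
    have hpi : ∀ b : (ρA.glued).functionField, ∃ (n : ℕ) (c : X.functionField),
        b ^ p ^ n = RatFn.functionFieldMap φ c := by
      intro b
      have hfix : ∀ g : G, RatFn.functionFieldMap (ρ g).hom (RatFn.functionFieldMap q b) =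
          RatFn.functionFieldMap q b := by
        intro g
        have key : ∀ (q' : X' ⟶ ρA.glued) [IsDominant q'], q' = q →
            RatFn.functionFieldMap q' = RatFn.functionFieldMap q := by
          rintro _ _ rfl; rfl
        have e : RatFn.functionFieldMap ((ρ g).hom ≫ q) = (RatFn.functionFieldMap (ρ g).hom).comp
            (RatFn.functionFieldMap q) := RatFn.functionFieldMap_comp q (ρ g).hom
        rw [← RingHom.comp_apply, ← e, key ((ρ g).hom ≫ q) (ρA.aut_hom_gluedMk hcov g)]
      obtain ⟨n, hn⟩ := hd (RatFn.functionFieldMap q b) hfix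
      rw [ringExpChar.eq X.functionField p] at hn
      obtain ⟨c, hc⟩ := hn
      refine ⟨n, c, ?_⟩
      apply (RatFn.functionFieldMap q).injective
      have key : ∀ (π' : X' ⟶ X) [IsDominant π'], π' = π →
          RatFn.functionFieldMap π' = RatFn.functionFieldMap π := by
        rintro _ _ rfl; rfl
      rw [map_pow, ← hc, ← key (q ≫ φ) hqφ, RatFn.functionFieldMap_comp φ q, RingHom.comp_apply]
    -- (3) radicial over a smaller open
    obtain ⟨V, hηV, -, hVfin, hVui⟩ :=
      exists_isFinite_universallyInjective_morphismRestrict φ hp hV₁aff hηV₁ hpi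
    exact ⟨V, V.isOpen.dense ⟨_, hηV⟩, hVfin, hVui⟩

/-! ## Glue 2: composition with `WQ_p` at a perfect field, for normal projective varieties -/

/-- **De Jong's reduction at a prime `p`, compositional half, squeezed**: Galois-type quotient
presentations of normal projective varieties over perfect fields of characteristic `p` plus `WQ_p`
give purely inseparable regular alterations of those varieties (resolve `X₁` by `WQ_p` and compose
with `φ`; de Jong 1996, 2.20). [cite: DeJong1996, 2.20] -/
theorem pialtPerfectNormalProjectiveAt_of_galoisQuotientAlterationAt {p : ℕ}
    (hGQA : ∀ (k : Type) [Field k] [CharP k p] [PerfectField k] (X : Scheme.{0})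
      (f : X ⟶ Spec (.of k)), IsSeparated f → LocallyOfFiniteType f → QuasiCompact f →
      IsIntegral X → (∀ x : X, IsIntegrallyClosed (X.presheaf.stalk x)) →
      Motives.IsProjectiveOver (Over.mk f) →
      ∃ (X' X₁ : Scheme.{0}) (q : X' ⟶ X₁) (φ : X₁ ⟶ X) (G : Type) (_ : Group G) (_ : Finite G)
        (ρ : G →* Aut X'), IsSeparated (φ ≫ f) ∧ LocallyOfFiniteType (φ ≫ f) ∧
        QuasiCompact (φ ≫ f) ∧ IsIntegral X₁ ∧ IsIntegral X' ∧ Scheme.IsRegular X' ∧ IsFinite q ∧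
        Function.Surjective q.base ∧ (∃ U : X₁.Opens, Dense (U : Set X₁) ∧ Etale (q ∣_ U)) ∧
        (∀ g : G, (ρ g).hom ≫ q = q) ∧ (∀ x y : X', q.base x = q.base y → ∃ g : G,
          (ρ g).hom.base x = y) ∧ IsProper φ ∧ Function.Surjective φ.base ∧
        ∃ V : X.Opens, Dense (V : Set X) ∧ IsFinite (φ ∣_ V) ∧ UniversallyInjective (φ ∣_ V))
    (hWQ : ∀ (k : Type) [Field k] [CharP k p] (X' X₁ : Scheme.{0}) (f : X₁ ⟶ Spec (.of k))
      (q : X' ⟶ X₁) (G : Type) [Group G] [Finite G] (ρ : G →* Aut X'),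
      IsSeparated f → LocallyOfFiniteType f → QuasiCompact f → IsIntegral X₁ → IsIntegral X' →
      Scheme.IsRegular X' → IsFinite q → Function.Surjective q.base →
      (∃ U : X₁.Opens, Dense (U : Set X₁) ∧ Etale (q ∣_ U)) → (∀ g : G, (ρ g).hom ≫ q = q) →
      (∀ x y : X', q.base x = q.base y → ∃ g : G, (ρ g).hom.base x = y) →
      Scheme.HasResolution X₁)
    (k : Type) [Field k] [CharP k p] [PerfectField k] (X : Scheme.{0}) (f : X ⟶ Spec (.of k))
    (hi : IsIntegral X) (hproj : Motives.IsProjectiveOver (Over.mk f))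
    (hN : ∀ x : X, IsIntegrallyClosed (X.presheaf.stalk x)) :
    ∃ (X' : Scheme.{0}) (g : X' ⟶ X), IsProper g ∧ IsIntegral X' ∧ Scheme.IsRegular X' ∧
      Function.Surjective g.base ∧
      ∃ U : X.Opens, Dense (U : Set X) ∧ IsFinite (g ∣_ U) ∧ UniversallyInjective (g ∣_ U) := by
  haveI := hi
  haveI : IsProper f := Motives.IsProjectiveOver.isProper hproj
  obtain ⟨X', X₁, q, φ, G, _, _, ρ, hs₁, hl₁, hq₁, hi₁, hi', hreg', hfin, hsurj, hU, hinv, horb,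
    hφp, hφs, V, hV, hVfin, hVui⟩ :=
    hGQA k X f inferInstance inferInstance inferInstance hi hN hproj
  -- resolve the quotient `X₁` by `WQ_p`
  have hres : Scheme.HasResolution X₁ :=
    hWQ k X' X₁ (φ ≫ f) q G ρ hs₁ hl₁ hq₁ hi₁ hi' hreg' hfin hsurj hU hinv horb
  obtain ⟨X₂, π, hπ⟩ := hres
  haveI : IsIntegral X₁ := hi₁
  -- `φ` is a purely inseparable alteration, and so is the resolution `π`; compose
  have hφ : IsPurelyInseparableAlteration φ :=
    { isIntegral := hi₁
      isProper := hφp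
      isDominant := ⟨hφs.denseRange⟩
      exists_isFinite_universallyInjective := ⟨V, hV.nonempty, hVfin, hVui⟩ }
  have hcomp : IsPurelyInseparableAlteration (π ≫ φ) := hπ.isPurelyInseparableAlteration.comp hφ
  haveI := hcomp.isProper
  haveI := hcomp.surjective
  obtain ⟨W, hW, hWfin, hWui⟩ := hcomp.exists_dense
  exact ⟨X₂, π ≫ φ, inferInstance, hcomp.isIntegral, hπ.isRegular, (π ≫ φ).surjective,
    W, hW, hWfin, hWui⟩

/-! ## Glue 3: the frame — de Jong is needed only for normal projective `X` over perfect fields -/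

/-- **Frame at a prime `p`** (ideator 2, re-proved from tree theorems): `ResolutionInChar p` follows
from `PICover_p` as soon as one has purely inseparable regular alterations of NORMAL PROJECTIVE
varieties over PERFECT fields of characteristic `p` — perfect closure + finite-level descent
(`stub_pialtOfPerfect`), Chow + normalisation (`pialtConclusion_of_forall_normal_isProjectiveOver`),
Theorem B (`hasResolution_of_thesis`, every field) and reduced → integral
(`DescentReducedToIntegral_holds`). [folklore] -/
theorem resolutionInChar_of_pialtPerfectNormalProjectiveAt_of_picoverAt (p : ℕ) (hp : p.Prime)
    (hPN : ∀ (K : Type) [Field K] [CharP K p] [PerfectField K] (X : Scheme.{0})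
      (f : X ⟶ Spec (.of K)), IsIntegral X → Motives.IsProjectiveOver (Over.mk f) →
      (∀ x : X, IsIntegrallyClosed (X.presheaf.stalk x)) →
        ∃ (X' : Scheme.{0}) (g : X' ⟶ X), IsProper g ∧ IsIntegral X' ∧ Scheme.IsRegular X' ∧
          Function.Surjective g.base ∧ ∃ U : X.Opens, Dense (U : Set X) ∧ IsFinite (g ∣_ U) ∧
            UniversallyInjective (g ∣_ U))
    (hPC : ∀ (k : Type) [Field k] [CharP k p] (Y X : Scheme.{0}) (f : Y ⟶ Spec (.of k))
      (g : X ⟶ Y), IsSeparated f → LocallyOfFiniteType f → QuasiCompact f → IsIntegral Y →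
      Scheme.IsRegular Y → IsIntegral X → IsFinite g → UniversallyInjective g →
      Function.Surjective g.base → Scheme.HasResolution X) :
    ResolutionInChar.{0} p := by
  haveI : Fact p.Prime := ⟨hp⟩
  have hPI : ∀ (k : Type) [Field k] [CharP k p] (X : Scheme.{0}) (f : X ⟶ Spec (.of k)),
      IsSeparated f → LocallyOfFiniteType f → QuasiCompact f → IsIntegral X →
      ∃ (X' : Scheme.{0}) (g : X' ⟶ X), IsProper g ∧ IsIntegral X' ∧ Scheme.IsRegular X' ∧
        Function.Surjective g.base ∧ ∃ U : X.Opens, Dense (U : Set X) ∧ IsFinite (g ∣_ U) ∧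
        UniversallyInjective (g ∣_ U) := by
    intro k _ _ X f hs hl hq hi
    haveI := hs; haveI := hl; haveI := hq; haveI := hi
    refine PalterationThesis.PerfectTransfer.stub_pialtOfPerfect p k (fun Y g h1 h2 h3 h4 => ?_) X f
    haveI := h1; haveI := h2; haveI := h3; haveI := h4
    exact pialtConclusion_of_forall_normal_isProjectiveOver g
      (fun X' f' hi' hproj hN => hPN (PerfectClosure k p) X' f' hi' hproj hN)
  intro k _ _ X f hs hl hq hred
  exact Theses.PAlteration.DescentReducedToIntegral_holds k (fun Y g h1 h2 h3 h4 => by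
      haveI := h1; haveI := h2; haveI := h3; haveI := h4
      exact hasResolution_of_thesis p hPI hPC g) X f hs hl hq hred

/-! ## The squeezed reduction at a prime -/

/-- **The de Jong reduction at a prime `p`, squeezed**: if every NORMAL PROJECTIVE integral
variety over every PERFECT field of characteristic `p` admits de Jong's Galois alteration
`(X₁, G, π)` (regular integral quasi-projective source, faithful `G`, `K(X) ⊂ K(X₁)^G` purely
inseparable — de Jong 1997, Thm. 5.13 / Cor. 5.15), then `WQ_p → PICover_p → ResolutionInChar p`.
[cite: DeJong1997, Thm. 5.13, Cor. 5.15] -/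
theorem resolutionInChar_of_galoisAlterationPerfectAt (p : ℕ) (hp : p.Prime)
    (hdJ : ∀ (k : Type) [Field k] [CharP k p] [PerfectField k]
      (X : Scheme.{0}) [IsIntegral X] (f : X ⟶ Spec (.of k)),
      IsSeparated f → LocallyOfFiniteType f → QuasiCompact f →
      (∀ x : X, IsIntegrallyClosed (X.presheaf.stalk x)) → Motives.IsProjectiveOver (Over.mk f) →
      ∃ (G : Type) (_ : Group G) (_ : Finite G) (X₁ : Scheme.{0}) (_ : IsIntegral X₁)
        (ρ : G →* Aut X₁) (π : X₁ ⟶ X) (_ : IsDominant π),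
        IsAlteration π ∧ Scheme.IsRegular X₁ ∧ Function.Injective ρ ∧
        (∀ g : G, (ρ g).hom ≫ π = π) ∧
        (∀ S : Finset X₁, ∃ U : X₁.Opens, IsAffineOpen U ∧ (↑S : Set X₁) ⊆ U) ∧
        (∀ a : X₁.functionField, (∀ g : G, RatFn.functionFieldMap (ρ g).hom a = a) →
          ∃ n : ℕ, a ^ ringExpChar X.functionField ^ n ∈ Set.range (RatFn.functionFieldMap π)))
    (hWQ : ∀ (k : Type) [Field k] [CharP k p] (X' X₁ : Scheme.{0}) (f : X₁ ⟶ Spec (.of k))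
      (q : X' ⟶ X₁) (G : Type) [Group G] [Finite G] (ρ : G →* Aut X'),
      IsSeparated f → LocallyOfFiniteType f → QuasiCompact f → IsIntegral X₁ → IsIntegral X' →
      Scheme.IsRegular X' → IsFinite q → Function.Surjective q.base →
      (∃ U : X₁.Opens, Dense (U : Set X₁) ∧ Etale (q ∣_ U)) → (∀ g : G, (ρ g).hom ≫ q = q) →
      (∀ x y : X', q.base x = q.base y → ∃ g : G, (ρ g).hom.base x = y) →
      Scheme.HasResolution X₁)
    (hPC : ∀ (k : Type) [Field k] [CharP k p] (Y X : Scheme.{0}) (f : Y ⟶ Spec (.of k))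
      (g : X ⟶ Y), IsSeparated f → LocallyOfFiniteType f → QuasiCompact f → IsIntegral Y →
      Scheme.IsRegular Y → IsIntegral X → IsFinite g → UniversallyInjective g →
      Function.Surjective g.base → Scheme.HasResolution X) :
    ResolutionInChar.{0} p := by
  refine resolutionInChar_of_pialtPerfectNormalProjectiveAt_of_picoverAt p hp ?_ hPC
  refine pialtPerfectNormalProjectiveAt_of_galoisQuotientAlterationAt (p := p) ?_ hWQ
  intro k _ _ _ X f hs hl hq hi hN hproj
  haveI := hs; haveI := hl; haveI := hq; haveI := hi
  exact galoisQuotientAlterationAt_of_deJong hp X f (hdJ k X f hs hl hq hN hproj)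

/-! ## The skeleton's composition -/

/-- The composition demanded of a line skeleton: the crux BY NAME, sorries only in `stub_*`. -/
theorem SummitReduction_of : Theses.WildQuotients.SummitReduction :=
  fun p hp hWQ hPC =>
    resolutionInChar_of_galoisAlterationPerfectAt p hp
      (fun k _ _ _ X _ f hs hl hq hN hproj =>
        deJong1997_galoisAlteration_perfect_of_pair p hp k X f hs hl hq hN hproj) hWQ hPC

end Summit.ResolutionOfSingularities.ResolutionOfSingularities.Theorems

end
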